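import Mathlib
import Literature.Analysis.FluidPDE.ChoiEtAl2017PeriodicHouLuoBlowup
import HarnessLib

/-!
# Choi–Hou–Kiselev–Luo–Šverák–Yao 2017, §4: the kernel lemma (Lemma 6) of the periodic Hou–Luo
# model, the sign law `ω ≥ 0 ⇒ u ≤ 0` on the half period, the CKY comparison, and the
# quadratic-feedback blow-up step — all PROVED

HONEST FRAMING (cell ns-blowup GROUP B «PROFILE SEARCH», zones Z3-b′ / Z8 = the Hou–Luo boundary
MODEL; human rulings D-0035/D-0074/D-0081): **1-D MODEL (Hou–Luo), not Euler/NS.** Nothing in this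
file is a statement about Euler or Navier–Stokes. Proof-only companion of
`ChoiEtAl2017PeriodicHouLuoBlowup.lean` (the model `periodicHLVelocity`, the data class
`ChoiEtAl2017.IsBlowupDatum`, the named fact `choiEtAl2017_periodicHouLuo_blowup`): it kernel-checks
the two dynamics-free ingredients of the printed proof of that fact,

* K. Choi, T. Y. Hou, A. Kiselev, G. Luo, V. Šverák, Y. Yao, *On the finite-time blowup of a
  one-dimensional model for the three-dimensional axisymmetric Euler equations*, Comm. Pure Appl.
  Math. **70** (2017) 2218–2243 = arXiv:1407.4776 [ChoiHouKiselevLuoSverakYao2017], §4 ("p." =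
  chunk of the held arXiv text `paper:arxiv-1407.4776`),

namely **Lemma 6** (p. 11) and the closing ODE step (gengron) (p. 13), together with the two
consequences of Lemma 6 printed on p. 11–12. No new definition of Prop type, no named fact
(net debt 0); this is stage A+B of the discharge of `choiEtAl2017_periodicHouLuo_blowup` (the
remaining stages — uniqueness/symmetry preservation, sign preservation along characteristics,
Lemma 7, assembly — are recorded in the seat notes of ns-blowup-profile-lit g8).

## What is printed (§4, p. 11–13) and what is proved here

* (p. 11) `u = Qω`, `Qω(x) = (1/π)∫₀^L ω(y) log|sin[μ(x−y)]| dy`, `μ = π/L`; for odd `L`-periodic `ω`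
  "the velocity `u` also becomes odd at `x = 0` and `½L`". PROVED (all in namespace `ChoiEtAl2017`):
  `periodicHLVelocity_add_period` / `periodic_periodicHLVelocity`, `periodicHLVelocity_neg` (oddness),
  `periodicHLVelocity_zero_pt`, `periodicHLVelocity_half`, `periodicHLVelocity_half_add` (odd about
  `½L`), and the folding over the half period `periodicHLVelocity_eq_half` :
  `u(x) = (1/π)∫₀^{L/2} ω(y){log|sin μ(x−y)| − log|sin μ(x+y)|} dy` (display (eqn_u), first line);
  integrability of the log kernels (`intervalIntegrable_log_abs_sin_sub/_add`,
  `intervalIntegrable_mul_log_abs_sin_sub/_add`).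
* **Lemma 6.** "Let `ω` be periodic with period `L` and odd at `x = 0` and let `u = Qω`. Then for any
  `x ∈ [0, ½L]`, `u(x) cot(μx) = −(1/π) ∫₀^{L/2} K(x,y) ω(y) cot(μy) dy`, where
  `K(x,y) = s log|(s+1)/(s−1)|` with `s = s(x,y) = tan(μy)/tan(μx)`. Furthermore (a) `K(x,y) ≥ 0`
  for all `x, y ∈ (0, ½L)` with `x ≠ y`; (b) `K(x,y) ≥ 2` and `K_x(x,y) ≥ 0` for all
  `0 < x < y < ½L`; (c) `K(x,y) ≥ 2s²` and `K_x(x,y) ≤ 0` for all `0 < y < x < ½L`."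
  PROVED: `ChoiEtAl2017.periodicHLVelocity_mul_cot` (the representation, for `x ∈ (0, ½L)`; at the
  end-points both sides vanish trivially), with the pointwise identity `kernelIntegrand_eq` and the
  integrability of the kernel integrand `intervalIntegrable_kernelIntegrand` (its log singularity at
  `y = x` is that of `Q`'s integrand); `hlKernel_nonneg` (a), `two_le_hlKernel` +
  `monotoneOn_hlKernel_left` (b), `two_mul_sq_le_hlKernel` + `antitoneOn_hlKernel_right` (c); the
  monotonicity statements ARE the printed sign conditions on `K_x` (we do not differentiate `K`;
  `hlRatio_antitoneOn` is the printed `s_x ≤ 0`).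
  The real-variable core: `hlKernelFn s = s·log((s+1)/(s−1))` (Lean's `Real.log` is even,
  `Real.log_abs`, so the printed modulus is automatic) with `two_mul_le_log_add_sub_log_sub`
  (`2r ≤ log(1+r) − log(1−r)`, the printed Taylor-series step done by a derivative sign) and
  `log_add_sub_log_sub_le` (`log(1+r) − log(1−r) ≤ 2r/(1−r²)`, the sign of `K_x`).
* (p. 11) "`θ_{0x}, ω₀ ≥ 0` on `[0, ½L]`. Then … `u₀ ≤ 0` on `[0, ½L]` (for the proof … see (eqn_u))."
  PROVED: `ChoiEtAl2017.periodicHLVelocity_nonpos` (with `kernelIntegrand_nonneg`).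
* (Remark after Lemma 6, p. 12) "the periodic HL-velocity is, up to a constant factor, 'stronger' than
  the CKY-velocity provided that `ω ≥ 0` on `[0, ½L]` … for any `z ∈ (0, ½L)` there exists a positive
  constant `C` depending on `L` and `z` such that `u_HL(x) ≤ −Cx ∫_x^z ω(y)/y dy` for all `x ∈ [0,z]`."
  PROVED with the explicit constant `C = 2cos(μz)/π`: `ChoiEtAl2017.periodicHLVelocity_le_cky`.
* (Proof of Theorem 1, p. 13, (gengron)) "`dI/dt ≥ J(0) + c₀∫₀ᵗ I² ≥ c₀∫₀ᵗ I²` … From this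
  inequality finite time blow up can be inferred in a standard way." PROVED as a self-contained real
  lemma: `ChoiEtAl2017.not_global_of_quadratic_feedback` (no `C¹` function on `[0,∞)` with
  `I(0) > 0` satisfies `I′(t) ≥ c₀∫₀ᵗ I²`, `c₀ > 0`) and the two-function form
  `ChoiEtAl2017.not_global_of_quadratic_feedback₂` (`I′ ≥ J`, `J′ ≥ c₀ I²`, `I(0) > 0`, `J(0) ≥ 0`).
  Our route to the contradiction: `I³ − (3c₀/2)F²` is nondecreasing (`F = ∫₀ᵗ I²`), so
  `F′ = I² ≥ (3c₀/2)^{2/3} F^{4/3}`, and `F^{−1/3}` decreases at a fixed rate — the printed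
  `h″ = 2c₀h(h′)^{1/2}` comparison in an equivalent first-order form.
* (Proof of Lemma 7, p. 12 — the KERNEL ALGEBRA, §8) "`G := K_x` … `T(x,y) = cot(μy)G(x,y) +
  cot(μx)G(y,x)` … `G(x,y) = −μ csc²(μx) tan(μy){log|(s+1)/(s−1)| − 2s/(s²−1)}` …
  `log|(s+1)/(s−1)| ≥ 2s/(s²+1)` … `T(x,y) ≤ 0` for all `x, y ∈ (0, ½L)`." PROVED: `hlKernelFnDeriv`
  (`φ′`) with `hasDerivAt_hlKernelFn_deriv`, `hlKernelFnDeriv_inv` (`φ′(1/s) = log|…| + 2s/(s²−1)`),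
  `two_mul_div_le_log_ratio`, `hasDerivAt_hlRatio_left` (`s_x = −μ tan(μy)/sin²(μx)`), the
  definition `hlKernelDx` (`G`) with `hasDerivAt_hlKernel_left` (`K_x = G` off the diagonal), the
  definition `hlSymKernel` (`T`) with `hlSymKernel_le` (the quantitative
  `T ≤ −4μ tan(μx)tan(μy)/(tan²μx + tan²μy)`) and `hlSymKernel_nonpos` (`T ≤ 0`). The remaining
  ANALYTIC part of Lemma 7 (the principal-value double integral `I₂ = (1/2π)∫∫ω_rω_r T` and
  `I₁ ≤ 0`) is not in this file.

## Tree / Mathlib search (R1)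

`lean search 'periodicHLVelocity|cotFunctional' --decl`: only the g6 file (reused, imported);
`lean search 'kernelK' --decl`: Elgindi's angular kernel `Literature.Analysis.FluidPDE.kernelK`
(unrelated) — hence the names `hlKernel`, `hlKernelFn`, `hlRatio` here; `lean search 'Riccati|
quadratic_feedback'`: no integro-differential blow-up lemma in the tree (Chen–Hou 2024's explicit
`riccati*` flows are unrelated). Mathlib: `MeromorphicOn.intervalIntegrable_log_norm` (integrability
of `log|sin|`), `monotoneOn_of_deriv_nonneg` / `antitoneOn_of_deriv_nonpos`,
`Convex.image_sub_le_mul_sub_of_deriv_le`, `intervalIntegral.integral_comp_sub_left`,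
`intervalIntegral.integral_hasDerivAt_right`, `Real.rpow` calculus.

WHAT THIS IS NOT: not Euler, not Navier–Stokes; no blow-up is asserted here — these are identities
and inequalities about the Biot–Savart law of the 1-D periodic wall MODEL and a real-variable ODE
lemma. `violates:` none — MODEL.
-/

noncomputable section

open Set Filter Real MeasureTheory intervalIntegral
open _root_.Topology

namespace Literature.Analysis.FluidPDE

namespace ChoiEtAl2017

/-! ### §1 Two logarithmic inequalities (the Taylor-series steps of Lemma 6 (b)/(c)) -/

/-- Auxiliary: `g₁(r) = log(1+r) − log(1−r) − 2r`. [folklore] -/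
private def gOne (r : ℝ) : ℝ := Real.log (1 + r) - Real.log (1 - r) - 2 * r

/-- Auxiliary: `g₂(r) = 2r/(1−r²) − (log(1+r) − log(1−r))`. [folklore] -/
private def gTwo (r : ℝ) : ℝ := 2 * r / (1 - r ^ 2) - (Real.log (1 + r) - Real.log (1 - r))

/-- `d/dr log(1+r) = 1/(1+r)`. [folklore] -/
private theorem hasDerivAt_log_one_add {s : ℝ} (hs : 0 < 1 + s) :
    HasDerivAt (fun r : ℝ => Real.log (1 + r)) (1 / (1 + s)) s := by
  have h := ((hasDerivAt_id' s).const_add 1).log hs.ne'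
  simpa [one_div] using h

/-- `d/dr log(1−r) = −1/(1−r)`. [folklore] -/
private theorem hasDerivAt_log_one_sub {s : ℝ} (hs : 0 < 1 - s) :
    HasDerivAt (fun r : ℝ => Real.log (1 - r)) (-1 / (1 - s)) s := by
  have h := ((hasDerivAt_id' s).const_sub 1).log hs.ne'
  simpa [neg_div, one_div] using h

/-- `g₁′(s) = 1/(1+s) + 1/(1−s) − 2` on `(0,1)`. [folklore] -/
private theorem hasDerivAt_gOne {s : ℝ} (hs : s ∈ Ioo (0 : ℝ) 1) :
    HasDerivAt gOne (1 / (1 + s) + 1 / (1 - s) - 2) s := by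
  have h1 := hasDerivAt_log_one_add (show 0 < 1 + s by linarith [hs.1])
  have h2 := hasDerivAt_log_one_sub (show 0 < 1 - s by linarith [hs.2])
  have h3 : HasDerivAt (fun r : ℝ => 2 * r) 2 s := by
    simpa using (hasDerivAt_id' s).const_mul 2
  have h : HasDerivAt gOne (1 / (1 + s) - -1 / (1 - s) - 2) s := (h1.sub h2).sub h3
  exact h.congr_deriv (by ring)

/-- `g₁` is continuous on `[0,1)`. [folklore] -/
private theorem continuousOn_gOne : ContinuousOn gOne (Ico (0 : ℝ) 1) := by
  intro s hs
  have h1 : 0 < 1 + s := by linarith [hs.1]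
  have h2 : 0 < 1 - s := by linarith [hs.2]
  have hc : ContinuousAt gOne s :=
    (((continuousAt_const.add continuousAt_id).log h1.ne').sub
      ((continuousAt_const.sub continuousAt_id).log h2.ne')).sub
      (continuousAt_const.mul continuousAt_id)
  exact hc.continuousWithinAt

/-- `2r ≤ log(1+r) − log(1−r)` for `0 ≤ r < 1` (CHKLSY's series `log((1+r)/(1−r)) = 2Σ r^{2n+1}/(2n+1)`;
here: the difference has derivative `2r²/(1−r²) ≥ 0` and vanishes at `0`).
[cite: ChoiHouKiselevLuoSverakYao2017, §4 Lemma 6 (proof of (b)/(c))] -/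
theorem two_mul_le_log_add_sub_log_sub {r : ℝ} (hr : r ∈ Ico (0 : ℝ) 1) :
    2 * r ≤ Real.log (1 + r) - Real.log (1 - r) := by
  have hmono : MonotoneOn gOne (Ico (0 : ℝ) 1) := by
    refine monotoneOn_of_deriv_nonneg (convex_Ico 0 1) continuousOn_gOne ?_ ?_
    · rw [interior_Ico]
      intro s hs
      exact (hasDerivAt_gOne hs).differentiableAt.differentiableWithinAt
    · rw [interior_Ico]
      intro s hs
      rw [(hasDerivAt_gOne hs).deriv]
      have h1 : 0 < 1 + s := by linarith [hs.1]
      have h2 : 0 < 1 - s := by linarith [hs.2]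
      rw [div_add_div _ _ h1.ne' h2.ne', sub_nonneg, le_div_iff₀ (mul_pos h1 h2)]
      nlinarith [hs.1]
  have h0 : gOne 0 = 0 := by simp [gOne]
  have := hmono (show (0 : ℝ) ∈ Ico (0 : ℝ) 1 from ⟨le_rfl, one_pos⟩) hr hr.1
  rw [h0] at this
  simp only [gOne] at this
  linarith

/-- `g₂′(s)` on `(0,1)` (quotient rule; equals `4s²/(1−s²)²`). [folklore] -/
private theorem hasDerivAt_gTwo {s : ℝ} (hs : s ∈ Ioo (0 : ℝ) 1) :
    HasDerivAt gTwo ((2 * (1 - s ^ 2) - 2 * s * (-(2 * s))) / (1 - s ^ 2) ^ 2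
        - (1 / (1 + s) + 1 / (1 - s))) s := by
  have hden : (1 - s ^ 2 : ℝ) ≠ 0 := by nlinarith [hs.1, hs.2]
  have hnum : HasDerivAt (fun r : ℝ => 2 * r) 2 s := by
    simpa using (hasDerivAt_id' s).const_mul 2
  have hd : HasDerivAt (fun r : ℝ => 1 - r ^ 2) (-(2 * s)) s := by
    have h := ((hasDerivAt_id' s).pow 2).const_sub 1
    simpa using h
  have hq := hnum.div hd hden
  have h1 := hasDerivAt_log_one_add (show 0 < 1 + s by linarith [hs.1])
  have h2 := hasDerivAt_log_one_sub (show 0 < 1 - s by linarith [hs.2])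
  have h : HasDerivAt gTwo ((2 * (1 - s ^ 2) - 2 * s * (-(2 * s))) / (1 - s ^ 2) ^ 2
      - (1 / (1 + s) - -1 / (1 - s))) s := hq.sub (h1.sub h2)
  exact h.congr_deriv (by ring)

/-- `g₂` is continuous on `[0,1)`. [folklore] -/
private theorem continuousOn_gTwo : ContinuousOn gTwo (Ico (0 : ℝ) 1) := by
  intro s hs
  have h1 : 0 < 1 + s := by linarith [hs.1]
  have h2 : 0 < 1 - s := by linarith [hs.2]
  have hden : (1 - s ^ 2 : ℝ) ≠ 0 := by nlinarith [hs.1, hs.2]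
  have hc : ContinuousAt gTwo s :=
    ((continuousAt_const.mul continuousAt_id).div
        (continuousAt_const.sub (continuousAt_id.pow 2)) hden).sub
      (((continuousAt_const.add continuousAt_id).log h1.ne').sub
        ((continuousAt_const.sub continuousAt_id).log h2.ne'))
  exact hc.continuousWithinAt

/-- `log(1+r) − log(1−r) ≤ 2r/(1−r²)` for `0 ≤ r < 1` (the difference `2r/(1−r²) − log((1+r)/(1−r))`
has derivative `4r²/(1−r²)² ≥ 0` and vanishes at `0`); with `r = 1/s` this is the printed sign
`K_x ≥ 0` for `x < y`, i.e. `φ′(s) = log((s+1)/(s−1)) − 2s/(s²−1) ≤ 0` for `s > 1`.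
[cite: ChoiHouKiselevLuoSverakYao2017, §4 Lemma 6 (proof of (b))] -/
theorem log_add_sub_log_sub_le {r : ℝ} (hr : r ∈ Ico (0 : ℝ) 1) :
    Real.log (1 + r) - Real.log (1 - r) ≤ 2 * r / (1 - r ^ 2) := by
  have hmono : MonotoneOn gTwo (Ico (0 : ℝ) 1) := by
    refine monotoneOn_of_deriv_nonneg (convex_Ico 0 1) continuousOn_gTwo ?_ ?_
    · rw [interior_Ico]
      intro s hs
      exact (hasDerivAt_gTwo hs).differentiableAt.differentiableWithinAt
    · rw [interior_Ico]
      intro s hs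
      rw [(hasDerivAt_gTwo hs).deriv]
      have h1 : 0 < 1 + s := by linarith [hs.1]
      have h2 : 0 < 1 - s := by linarith [hs.2]
      have h12 : (1 - s ^ 2 : ℝ) = (1 + s) * (1 - s) := by ring
      have hpos : 0 < (1 - s ^ 2 : ℝ) := by rw [h12]; exact mul_pos h1 h2
      -- the derivative equals `4 s² / (1 − s²)²`
      have hval : (2 * (1 - s ^ 2) - 2 * s * (-(2 * s))) / (1 - s ^ 2) ^ 2
          - (1 / (1 + s) + 1 / (1 - s)) = 4 * s ^ 2 / (1 - s ^ 2) ^ 2 := by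
        field_simp
        ring
      rw [hval]
      positivity
  have h0 : gTwo 0 = 0 := by simp [gTwo]
  have := hmono (show (0 : ℝ) ∈ Ico (0 : ℝ) 1 from ⟨le_rfl, one_pos⟩) hr hr.1
  rw [h0] at this
  simp only [gTwo] at this
  linarith

/-! ### §2 The kernel as a function of the ratio `s`: `φ(s) = s log|(s+1)/(s−1)|` -/

/-- CHKLSY's kernel as a function of the ratio `s`: `φ(s) = s·log|(s+1)/(s−1)|` (Lean's `Real.log`
is even — `Real.log_abs` — so the modulus is written without `|·|`; at `s = 1` the junk value is
`φ(1) = 0`). [cite: ChoiHouKiselevLuoSverakYao2017, §4 Lemma 6 (eqn_K)] -/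
def hlKernelFn (s : ℝ) : ℝ := s * Real.log ((s + 1) / (s - 1))

/-- `φ(s) = s·log|(s+1)/(s−1)|`, the printed form. [cite: ChoiHouKiselevLuoSverakYao2017, §4 Lemma 6 (eqn_K)] -/
theorem hlKernelFn_eq_abs (s : ℝ) : hlKernelFn s = s * Real.log |(s + 1) / (s - 1)| := by
  rw [hlKernelFn, Real.log_abs]

/-- For `s > 1`, with `r = s⁻¹`: `(s+1)/(s−1) = (1+r)/(1−r)`. [folklore] -/
private theorem ratio_eq_of_one_lt {s : ℝ} (hs : 0 < s) :
    (s + 1) / (s - 1) = (1 + s⁻¹) / (1 - s⁻¹) := by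
  have hs0 : s ≠ 0 := hs.ne'
  field_simp

/-- **Lemma 6 (a)**: `φ(s) ≥ 0` for every `s ≥ 0` (for `s ≠ 1`: `|s+1| ≥ |s−1|`; `φ(1) = 0`).
[cite: ChoiHouKiselevLuoSverakYao2017, §4 Lemma 6 (a)] -/
theorem hlKernelFn_nonneg {s : ℝ} (hs : 0 ≤ s) : 0 ≤ hlKernelFn s := by
  unfold hlKernelFn
  rcases eq_or_ne s 1 with h1 | h1
  · subst h1; simp
  refine mul_nonneg hs ?_
  rw [← Real.log_abs, abs_div]
  apply Real.log_nonneg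
  rw [le_div_iff₀ (abs_pos.2 (sub_ne_zero.2 h1)), one_mul]
  rw [abs_of_nonneg (by linarith : (0 : ℝ) ≤ s + 1)]
  exact abs_le.2 ⟨by linarith, by linarith⟩

/-- **Lemma 6 (b), value**: `φ(s) ≥ 2` for `s > 1` (`φ(s) = s·(log(1+r) − log(1−r)) ≥ s·2r = 2`, `r = 1/s`).
[cite: ChoiHouKiselevLuoSverakYao2017, §4 Lemma 6 (b)] -/
theorem two_le_hlKernelFn {s : ℝ} (hs : 1 < s) : 2 ≤ hlKernelFn s := by
  have hs0 : 0 < s := by linarith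
  have hr : s⁻¹ ∈ Ico (0 : ℝ) 1 := ⟨by positivity, inv_lt_one_of_one_lt₀ hs⟩
  have hr1 : 0 < 1 - s⁻¹ := by linarith [hr.2]
  have hr2 : 0 < 1 + s⁻¹ := by linarith [hr.1]
  unfold hlKernelFn
  rw [ratio_eq_of_one_lt hs0, Real.log_div hr2.ne' hr1.ne']
  have h := two_mul_le_log_add_sub_log_sub hr
  calc (2 : ℝ) = s * (2 * s⁻¹) := by field_simp
    _ ≤ s * (Real.log (1 + s⁻¹) - Real.log (1 - s⁻¹)) :=
        mul_le_mul_of_nonneg_left h hs0.le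

/-- **Lemma 6 (c), value**: `φ(s) ≥ 2s²` for `0 < s < 1` (`φ(s) = s·(log(1+s) − log(1−s)) ≥ s·2s`).
[cite: ChoiHouKiselevLuoSverakYao2017, §4 Lemma 6 (c)] -/
theorem two_mul_sq_le_hlKernelFn {s : ℝ} (hs : s ∈ Ioo (0 : ℝ) 1) : 2 * s ^ 2 ≤ hlKernelFn s := by
  have h1 : 0 < 1 + s := by linarith [hs.1]
  have h2 : 0 < 1 - s := by linarith [hs.2]
  unfold hlKernelFn
  have hrw : Real.log ((s + 1) / (s - 1)) = Real.log (1 + s) - Real.log (1 - s) := by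
    rw [← Real.log_abs, abs_div, abs_of_pos (by linarith : (0 : ℝ) < s + 1),
      abs_of_neg (by linarith : s - 1 < 0), neg_sub, add_comm, Real.log_div h1.ne' h2.ne']
  rw [hrw]
  have h := two_mul_le_log_add_sub_log_sub ⟨hs.1.le, hs.2⟩
  calc 2 * s ^ 2 = s * (2 * s) := by ring
    _ ≤ s * (Real.log (1 + s) - Real.log (1 - s)) := mul_le_mul_of_nonneg_left h hs.1.le

/-- The derivative of `φ` off `s = ±1`: `φ′(s) = log((s+1)/(s−1)) − 2s/(s²−1)`. [folklore] -/
private theorem hasDerivAt_hlKernelFn {s : ℝ} (h1 : s ≠ 1) (h2 : s ≠ -1) :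
    HasDerivAt hlKernelFn (Real.log ((s + 1) / (s - 1)) - 2 * s / (s ^ 2 - 1)) s := by
  have hs1 : s - 1 ≠ 0 := sub_ne_zero.2 h1
  have hs2 : s + 1 ≠ 0 := fun h => h2 (by linarith)
  have hq : HasDerivAt (fun r : ℝ => (r + 1) / (r - 1))
      ((1 * (s - 1) - (s + 1) * 1) / (s - 1) ^ 2) s :=
    ((hasDerivAt_id s).add_const 1).div ((hasDerivAt_id s).sub_const 1) hs1
  have hne : (s + 1) / (s - 1) ≠ 0 := div_ne_zero hs2 hs1
  have hlog := hq.log hne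
  have hprod : HasDerivAt hlKernelFn
      (1 * Real.log ((s + 1) / (s - 1)) +
        s * ((1 * (s - 1) - (s + 1) * 1) / (s - 1) ^ 2 / ((s + 1) / (s - 1)))) s :=
    (hasDerivAt_id' s).mul hlog
  refine hprod.congr_deriv ?_
  have hs3 : s ^ 2 - 1 ≠ 0 := by
    have : s ^ 2 - 1 = (s + 1) * (s - 1) := by ring
    rw [this]; exact mul_ne_zero hs2 hs1
  field_simp
  ring

/-- **Lemma 6 (b), monotonicity**: `φ` is non-increasing on `(1, ∞)` (`φ′ ≤ 0` there, by
`log_add_sub_log_sub_le` with `r = 1/s`) — the printed `K_x ≥ 0` for `x < y`, since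
`s = tan(μy)/tan(μx)` decreases in `x`. [cite: ChoiHouKiselevLuoSverakYao2017, §4 Lemma 6 (b)] -/
theorem antitoneOn_hlKernelFn : AntitoneOn hlKernelFn (Ioi (1 : ℝ)) := by
  have hd : ∀ s ∈ Ioi (1 : ℝ), HasDerivAt hlKernelFn
      (Real.log ((s + 1) / (s - 1)) - 2 * s / (s ^ 2 - 1)) s :=
    fun s hs => hasDerivAt_hlKernelFn (ne_of_gt hs) (by linarith [mem_Ioi.1 hs])
  refine antitoneOn_of_deriv_nonpos (convex_Ioi 1)
    (fun s hs => (hd s hs).continuousAt.continuousWithinAt) ?_ ?_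
  · rw [interior_Ioi]
    exact fun s hs => (hd s hs).differentiableAt.differentiableWithinAt
  · rw [interior_Ioi]
    intro s hs
    have hs1 : (1 : ℝ) < s := hs
    have hs0 : 0 < s := by linarith
    rw [(hd s hs).deriv, sub_nonpos]
    have hr : s⁻¹ ∈ Ico (0 : ℝ) 1 := ⟨by positivity, inv_lt_one_of_one_lt₀ hs1⟩
    have hr1 : 0 < 1 - s⁻¹ := by linarith [hr.2]
    have hr2 : 0 < 1 + s⁻¹ := by linarith [hr.1]
    have h := log_add_sub_log_sub_le hr
    rw [ratio_eq_of_one_lt hs0, Real.log_div hr2.ne' hr1.ne']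
    have hval : 2 * s⁻¹ / (1 - s⁻¹ ^ 2) = 2 * s / (s ^ 2 - 1) := by
      have hden : s ^ 2 - 1 ≠ 0 := by nlinarith
      field_simp
    rwa [hval] at h

/-- **Lemma 6 (c), monotonicity**: `φ` is non-decreasing on `(0, 1)` (`φ′ = log|(s+1)/(s−1)| +
2s/(1−s²) ≥ 0` there) — the printed `K_x ≤ 0` for `y < x`. [cite: ChoiHouKiselevLuoSverakYao2017, §4 Lemma 6 (c)] -/
theorem monotoneOn_hlKernelFn : MonotoneOn hlKernelFn (Ioo (0 : ℝ) 1) := by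
  have hd : ∀ s ∈ Ioo (0 : ℝ) 1, HasDerivAt hlKernelFn
      (Real.log ((s + 1) / (s - 1)) - 2 * s / (s ^ 2 - 1)) s :=
    fun s hs => hasDerivAt_hlKernelFn (ne_of_lt hs.2) (by linarith [hs.1])
  refine monotoneOn_of_deriv_nonneg (convex_Ioo 0 1)
    (fun s hs => (hd s hs).continuousAt.continuousWithinAt) ?_ ?_
  · rw [interior_Ioo]
    exact fun s hs => (hd s hs).differentiableAt.differentiableWithinAt
  · rw [interior_Ioo]
    intro s hs
    rw [(hd s hs).deriv]
    have h1 : 0 < 1 + s := by linarith [hs.1]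
    have h2 : 0 < 1 - s := by linarith [hs.2]
    have hlog : 0 ≤ Real.log ((s + 1) / (s - 1)) := by
      rw [← Real.log_abs, abs_div, abs_of_pos (by linarith : (0 : ℝ) < s + 1),
        abs_of_neg (by linarith : s - 1 < 0), neg_sub]
      apply Real.log_nonneg
      rw [le_div_iff₀ h2]
      linarith [hs.1]
    have hfrac : 0 ≤ -(2 * s / (s ^ 2 - 1)) := by
      rw [← neg_div, div_nonneg_iff]
      right
      constructor <;> nlinarith [hs.1, hs.2]
    linarith

/-! ### §3 The kernel `K(x,y)` of Lemma 6 and its printed properties (a)–(c) -/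

/-- CHKLSY's ratio `s(x,y) = tan(μy)/tan(μx)`, `μ = π/L` (the phase `μx` is written `π*x/L`, as in
`periodicHLVelocity`). [cite: ChoiHouKiselevLuoSverakYao2017, §4 Lemma 6 (eqn_K)] -/
def hlRatio (L x y : ℝ) : ℝ := Real.tan (π * y / L) / Real.tan (π * x / L)

/-- **CHKLSY's kernel** `K(x,y) = s·log|(s+1)/(s−1)|`, `s = s(x,y) = tan(μy)/tan(μx)` (eqn_K).
[cite: ChoiHouKiselevLuoSverakYao2017, §4 Lemma 6 (eqn_K)] -/
def hlKernel (L x y : ℝ) : ℝ := hlKernelFn (hlRatio L x y)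

/-- The printed form `K(x,y) = s log|(s+1)/(s−1)|`. [cite: ChoiHouKiselevLuoSverakYao2017, §4 Lemma 6 (eqn_K)] -/
theorem hlKernel_eq (L x y : ℝ) :
    hlKernel L x y = hlRatio L x y * Real.log |(hlRatio L x y + 1) / (hlRatio L x y - 1)| := by
  rw [hlKernel, hlKernelFn_eq_abs]

/-- For `0 < L` and `x ∈ (0, L/2)` the phase `μx = πx/L` lies in `(0, π/2)`. [folklore] -/
private theorem phase_mem_Ioo {L x : ℝ} (hL : 0 < L) (hx : x ∈ Ioo 0 (L / 2)) :
    π * x / L ∈ Ioo 0 (π / 2) := by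
  constructor
  · exact div_pos (mul_pos Real.pi_pos hx.1) hL
  · rw [div_lt_iff₀ hL]
    have := hx.2
    nlinarith [Real.pi_pos]

/-- For `0 < L` and `x ∈ [0, L/2]` the phase `μx = πx/L` lies in `[0, π/2]`. [folklore] -/
private theorem phase_mem_Icc {L x : ℝ} (hL : 0 < L) (hx : x ∈ Icc 0 (L / 2)) :
    π * x / L ∈ Icc 0 (π / 2) := by
  constructor
  · exact div_nonneg (mul_nonneg Real.pi_pos.le hx.1) hL.le
  · rw [div_le_iff₀ hL]
    have := hx.2
    nlinarith [Real.pi_pos]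

/-- `tan(μx) > 0` for `x ∈ (0, L/2)`. [folklore] -/
private theorem tan_phase_pos {L x : ℝ} (hL : 0 < L) (hx : x ∈ Ioo 0 (L / 2)) :
    0 < Real.tan (π * x / L) :=
  Real.tan_pos_of_pos_of_lt_pi_div_two (phase_mem_Ioo hL hx).1 (phase_mem_Ioo hL hx).2

/-- `tan(μy) ≥ 0` for `y ∈ [0, L/2]`. [folklore] -/
private theorem tan_phase_nonneg {L y : ℝ} (hL : 0 < L) (hy : y ∈ Icc 0 (L / 2)) :
    0 ≤ Real.tan (π * y / L) :=
  Real.tan_nonneg_of_nonneg_of_le_pi_div_two (phase_mem_Icc hL hy).1 (phase_mem_Icc hL hy).2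

/-- `tan(μ·)` is strictly increasing on `(0, L/2)`. [folklore] -/
private theorem tan_phase_lt {L x y : ℝ} (hL : 0 < L) (hx : x ∈ Ioo 0 (L / 2))
    (hy : y ∈ Ioo 0 (L / 2)) (hxy : x < y) :
    Real.tan (π * x / L) < Real.tan (π * y / L) := by
  refine Real.tan_lt_tan_of_lt_of_lt_pi_div_two ?_ (phase_mem_Ioo hL hy).2 ?_
  · linarith [(phase_mem_Ioo hL hx).1, Real.pi_pos]
  · rw [div_lt_div_iff_of_pos_right hL]
    exact mul_lt_mul_of_pos_left hxy Real.pi_pos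

/-- The ratio `s(x,y) ≥ 0` for `x ∈ (0, L/2)`, `y ∈ [0, L/2]`. [cite: ChoiHouKiselevLuoSverakYao2017, §4 Lemma 6 (proof of (a))] -/
theorem hlRatio_nonneg {L x y : ℝ} (hL : 0 < L) (hx : x ∈ Ioo 0 (L / 2)) (hy : y ∈ Icc 0 (L / 2)) :
    0 ≤ hlRatio L x y :=
  div_nonneg (tan_phase_nonneg hL hy) (tan_phase_pos hL hx).le

/-- `s(x,y) > 1` for `0 < x < y < L/2`. [cite: ChoiHouKiselevLuoSverakYao2017, §4 Lemma 6 (proof of (b))] -/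
theorem one_lt_hlRatio {L x y : ℝ} (hL : 0 < L) (hx : x ∈ Ioo 0 (L / 2)) (hy : y ∈ Ioo 0 (L / 2))
    (hxy : x < y) : 1 < hlRatio L x y := by
  rw [hlRatio, one_lt_div (tan_phase_pos hL hx)]
  exact tan_phase_lt hL hx hy hxy

/-- `0 < s(x,y) < 1` for `0 < y < x < L/2`. [cite: ChoiHouKiselevLuoSverakYao2017, §4 Lemma 6 (proof of (c))] -/
theorem hlRatio_mem_Ioo {L x y : ℝ} (hL : 0 < L) (hx : x ∈ Ioo 0 (L / 2)) (hy : y ∈ Ioo 0 (L / 2))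
    (hyx : y < x) : hlRatio L x y ∈ Ioo (0 : ℝ) 1 := by
  refine ⟨div_pos (tan_phase_pos hL hy) (tan_phase_pos hL hx), ?_⟩
  rw [hlRatio, div_lt_one (tan_phase_pos hL hx)]
  exact tan_phase_lt hL hy hx hyx

/-- For fixed `y ∈ [0, L/2]`, `x ↦ s(x,y)` is non-increasing on `(0, L/2)` ("observing that
`s_x(x,y) ≤ 0`": `tan(μx)` increases). [cite: ChoiHouKiselevLuoSverakYao2017, §4 Lemma 6 (proof of (b), s_x ≤ 0)] -/
theorem hlRatio_antitoneOn {L y : ℝ} (hL : 0 < L) (hy : y ∈ Icc 0 (L / 2)) :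
    AntitoneOn (fun x => hlRatio L x y) (Ioo 0 (L / 2)) := by
  intro x₁ hx₁ x₂ hx₂ h12
  simp only [hlRatio]
  rcases h12.lt_or_eq with h | h
  · exact div_le_div_of_nonneg_left (tan_phase_nonneg hL hy) (tan_phase_pos hL hx₁)
      (tan_phase_lt hL hx₁ hx₂ h).le
  · rw [h]

/-- **Lemma 6 (a)**: `K(x,y) ≥ 0` for `x ∈ (0, L/2)`, `y ∈ [0, L/2]` (printed for `x ≠ y` in the
open square; at `y = x` and at the end-points the Lean value is `0`).
[cite: ChoiHouKiselevLuoSverakYao2017, §4 Lemma 6 (a)] -/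
theorem hlKernel_nonneg {L x y : ℝ} (hL : 0 < L) (hx : x ∈ Ioo 0 (L / 2)) (hy : y ∈ Icc 0 (L / 2)) :
    0 ≤ hlKernel L x y :=
  hlKernelFn_nonneg (hlRatio_nonneg hL hx hy)

/-- **Lemma 6 (b), value**: `K(x,y) ≥ 2` for `0 < x < y < L/2`. [cite: ChoiHouKiselevLuoSverakYao2017, §4 Lemma 6 (b)] -/
theorem two_le_hlKernel {L x y : ℝ} (hL : 0 < L) (hx : x ∈ Ioo 0 (L / 2)) (hy : y ∈ Ioo 0 (L / 2))
    (hxy : x < y) : 2 ≤ hlKernel L x y :=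
  two_le_hlKernelFn (one_lt_hlRatio hL hx hy hxy)

/-- **Lemma 6 (c), value**: `K(x,y) ≥ 2s²` for `0 < y < x < L/2`. [cite: ChoiHouKiselevLuoSverakYao2017, §4 Lemma 6 (c)] -/
theorem two_mul_sq_le_hlKernel {L x y : ℝ} (hL : 0 < L) (hx : x ∈ Ioo 0 (L / 2))
    (hy : y ∈ Ioo 0 (L / 2)) (hyx : y < x) : 2 * hlRatio L x y ^ 2 ≤ hlKernel L x y :=
  two_mul_sq_le_hlKernelFn (hlRatio_mem_Ioo hL hx hy hyx)

/-- **Lemma 6 (b), sign of `K_x`**: for fixed `y ∈ (0, L/2)`, `x ↦ K(x,y)` is non-decreasing on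
`(0, y)` — the printed "`K_x(x,y) ≥ 0` for all `0 < x < y < ½L`", stated without differentiating.
[cite: ChoiHouKiselevLuoSverakYao2017, §4 Lemma 6 (b)] -/
theorem monotoneOn_hlKernel_left {L y : ℝ} (hL : 0 < L) (hy : y ∈ Ioo 0 (L / 2)) :
    MonotoneOn (fun x => hlKernel L x y) (Ioo 0 y) := by
  intro x₁ hx₁ x₂ hx₂ h12
  have hx₁' : x₁ ∈ Ioo 0 (L / 2) := ⟨hx₁.1, hx₁.2.trans hy.2⟩
  have hx₂' : x₂ ∈ Ioo 0 (L / 2) := ⟨hx₂.1, hx₂.2.trans hy.2⟩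
  have hs₁ : 1 < hlRatio L x₁ y := one_lt_hlRatio hL hx₁' hy hx₁.2
  have hs₂ : 1 < hlRatio L x₂ y := one_lt_hlRatio hL hx₂' hy hx₂.2
  have hs : hlRatio L x₂ y ≤ hlRatio L x₁ y :=
    hlRatio_antitoneOn hL ⟨hy.1.le, hy.2.le⟩ hx₁' hx₂' h12
  exact antitoneOn_hlKernelFn (mem_Ioi.2 hs₂) (mem_Ioi.2 hs₁) hs

/-- **Lemma 6 (c), sign of `K_x`**: for fixed `y ∈ (0, L/2)`, `x ↦ K(x,y)` is non-increasing on
`(y, L/2)` — the printed "`K_x(x,y) ≤ 0` for all `0 < y < x < ½L`".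
[cite: ChoiHouKiselevLuoSverakYao2017, §4 Lemma 6 (c)] -/
theorem antitoneOn_hlKernel_right {L y : ℝ} (hL : 0 < L) (hy : y ∈ Ioo 0 (L / 2)) :
    AntitoneOn (fun x => hlKernel L x y) (Ioo y (L / 2)) := by
  intro x₁ hx₁ x₂ hx₂ h12
  have hx₁' : x₁ ∈ Ioo 0 (L / 2) := ⟨hy.1.trans hx₁.1, hx₁.2⟩
  have hx₂' : x₂ ∈ Ioo 0 (L / 2) := ⟨hy.1.trans hx₂.1, hx₂.2⟩
  have hs₁ : hlRatio L x₁ y ∈ Ioo (0 : ℝ) 1 := hlRatio_mem_Ioo hL hx₁' hy hx₁.1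
  have hs₂ : hlRatio L x₂ y ∈ Ioo (0 : ℝ) 1 := hlRatio_mem_Ioo hL hx₂' hy hx₂.1
  have hs : hlRatio L x₂ y ≤ hlRatio L x₁ y :=
    hlRatio_antitoneOn hL ⟨hy.1.le, hy.2.le⟩ hx₁' hx₂' h12
  exact monotoneOn_hlKernelFn hs₂ hs₁ hs

/-! ### §4 The log kernel of `Q`: integrability, periodicity, oddness, folding (p. 11) -/

/-- `y ↦ log|sin(cy + d)|` is interval integrable on every interval (`log ∘ |f|` for the real-analytic
`f = sin(c· + d)`; Mathlib's `MeromorphicOn.intervalIntegrable_log_norm`). [folklore] -/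
private theorem intervalIntegrable_log_abs_sin_affine (c d a b : ℝ) :
    IntervalIntegrable (fun y : ℝ => Real.log |Real.sin (c * y + d)|) volume a b := by
  have h1 : AnalyticOnNhd ℝ (fun y : ℝ => c * y + d) univ :=
    (analyticOnNhd_const.mul analyticOnNhd_id).add analyticOnNhd_const
  have han : AnalyticOnNhd ℝ (fun y : ℝ => Real.sin (c * y + d)) univ :=
    Real.analyticOnNhd_sin.comp h1 (mapsTo_univ _ _)
  have h := (han.mono (subset_univ (uIcc a b))).meromorphicOn.intervalIntegrable_log_norm
  simpa only [Real.norm_eq_abs] using h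

/-- `y ↦ log|sin(π(x−y)/L)|`, the kernel of `Q`, is interval integrable on every interval.
[cite: ChoiHouKiselevLuoSverakYao2017, §4 p. 11 (u = Qω)] -/
theorem intervalIntegrable_log_abs_sin_sub (L x a b : ℝ) :
    IntervalIntegrable (fun y : ℝ => Real.log |Real.sin (π * (x - y) / L)|) volume a b := by
  have h := intervalIntegrable_log_abs_sin_affine (-π / L) (π * x / L) a b
  refine h.congr fun y _ => ?_
  simp only [show -π / L * y + π * x / L = π * (x - y) / L by ring]

/-- `y ↦ log|sin(π(x+y)/L)|`, the reflected kernel, is interval integrable on every interval.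
[cite: ChoiHouKiselevLuoSverakYao2017, §4 Lemma 6 (eqn_u)] -/
theorem intervalIntegrable_log_abs_sin_add (L x a b : ℝ) :
    IntervalIntegrable (fun y : ℝ => Real.log |Real.sin (π * (x + y) / L)|) volume a b := by
  have h := intervalIntegrable_log_abs_sin_affine (π / L) (π * x / L) a b
  refine h.congr fun y _ => ?_
  simp only [show π / L * y + π * x / L = π * (x + y) / L by ring]

/-- The integrand of `Qω(x)` is interval integrable for continuous `ω`. [cite: ChoiHouKiselevLuoSverakYao2017, §4 p. 11 (u = Qω)] -/
theorem intervalIntegrable_mul_log_abs_sin_sub {ω : ℝ → ℝ} (hω : Continuous ω) (L x a b : ℝ) :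
    IntervalIntegrable (fun y : ℝ => ω y * Real.log |Real.sin (π * (x - y) / L)|) volume a b :=
  (intervalIntegrable_log_abs_sin_sub L x a b).continuousOn_mul hω.continuousOn

/-- The reflected integrand is interval integrable for continuous `ω`. [cite: ChoiHouKiselevLuoSverakYao2017, §4 Lemma 6 (eqn_u)] -/
theorem intervalIntegrable_mul_log_abs_sin_add {ω : ℝ → ℝ} (hω : Continuous ω) (L x a b : ℝ) :
    IntervalIntegrable (fun y : ℝ => ω y * Real.log |Real.sin (π * (x + y) / L)|) volume a b :=
  (intervalIntegrable_log_abs_sin_add L x a b).continuousOn_mul hω.continuousOn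

/-- **`u = Qω` is `L`-periodic** (the kernel is: `sin(μ(x+L−y)) = −sin(μ(x−y))`).
[cite: ChoiHouKiselevLuoSverakYao2017, §4 p. 11 (u = Qω, periodic setting)] -/
theorem periodicHLVelocity_add_period {L : ℝ} (hL : L ≠ 0) (ω : ℝ → ℝ) (x : ℝ) :
    periodicHLVelocity L ω (x + L) = periodicHLVelocity L ω x := by
  unfold periodicHLVelocity
  congr 1
  refine intervalIntegral.integral_congr fun y _ => ?_
  have h : π * (x + L - y) / L = π * (x - y) / L + π := by
    field_simp
    ring
  simp only [h, Real.sin_add_pi, abs_neg]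

/-- `u = Qω` as a periodic function. [cite: ChoiHouKiselevLuoSverakYao2017, §4 p. 11 (u = Qω, periodic setting)] -/
theorem periodic_periodicHLVelocity {L : ℝ} (hL : L ≠ 0) (ω : ℝ → ℝ) :
    Function.Periodic (periodicHLVelocity L ω) L :=
  fun x => periodicHLVelocity_add_period hL ω x

/-- **`u = Qω` is odd when `ω` is odd and `L`-periodic** ("the initial velocity `u₀` also becomes odd
at `x = 0`", p. 11): substitute `y ↦ L − y` in `Qω(−x)`. [cite: ChoiHouKiselevLuoSverakYao2017, §4 p. 11 (u odd at 0 and ½L)] -/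
theorem periodicHLVelocity_neg {L : ℝ} {ω : ℝ → ℝ} (hodd : ∀ y, ω (-y) = -ω y)
    (hper : Function.Periodic ω L) (x : ℝ) :
    periodicHLVelocity L ω (-x) = -periodicHLVelocity L ω x := by
  unfold periodicHLVelocity
  rw [← mul_neg, ← intervalIntegral.integral_neg]
  congr 1
  have hsub : (∫ z in (0 : ℝ)..L, ω (L - z) * Real.log |Real.sin (π * (-x - (L - z)) / L)|) =
      ∫ y in (0 : ℝ)..L, ω y * Real.log |Real.sin (π * (-x - y) / L)| := by
    rw [intervalIntegral.integral_comp_sub_left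
      (fun y => ω y * Real.log |Real.sin (π * (-x - y) / L)|) L]
    simp
  rw [← hsub]
  refine intervalIntegral.integral_congr fun z _ => ?_
  have hω : ω (L - z) = -ω z := by
    rw [show L - z = -z + L by ring, hper, hodd]
  rcases eq_or_ne L 0 with hL | hL
  · subst hL
    simp
  · have h : π * (-x - (L - z)) / L = -(π * (x - z) / L) - π := by
      field_simp
      ring
    simp only [hω, h, Real.sin_sub_pi, Real.sin_neg, neg_neg, neg_mul]

/-- `u(0) = 0` for odd periodic `ω`. [cite: ChoiHouKiselevLuoSverakYao2017, §4 p. 11 (u odd at 0 and ½L)] -/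
theorem periodicHLVelocity_zero_pt {L : ℝ} {ω : ℝ → ℝ} (hodd : ∀ y, ω (-y) = -ω y)
    (hper : Function.Periodic ω L) : periodicHLVelocity L ω 0 = 0 := by
  have h := periodicHLVelocity_neg (L := L) hodd hper 0
  rw [neg_zero] at h
  linarith

/-- `u(½L) = 0` for odd periodic `ω` ("odd at `x = ½L`"). [cite: ChoiHouKiselevLuoSverakYao2017, §4 p. 11 (u odd at 0 and ½L)] -/
theorem periodicHLVelocity_half {L : ℝ} (hL : L ≠ 0) {ω : ℝ → ℝ} (hodd : ∀ y, ω (-y) = -ω y)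
    (hper : Function.Periodic ω L) : periodicHLVelocity L ω (L / 2) = 0 := by
  have h1 := periodicHLVelocity_neg (L := L) hodd hper (L / 2)
  have h2 := periodicHLVelocity_add_period hL ω (-(L / 2))
  rw [show -(L / 2) + L = L / 2 by ring] at h2
  linarith

/-- **`u` is odd about `x = ½L`**: `u(½L + x) = −u(½L − x)` (odd and `L`-periodic).
[cite: ChoiHouKiselevLuoSverakYao2017, §4 p. 11 (u odd at 0 and ½L)] -/
theorem periodicHLVelocity_half_add {L : ℝ} (hL : L ≠ 0) {ω : ℝ → ℝ} (hodd : ∀ y, ω (-y) = -ω y)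
    (hper : Function.Periodic ω L) (x : ℝ) :
    periodicHLVelocity L ω (L / 2 + x) = -periodicHLVelocity L ω (L / 2 - x) := by
  have h1 := periodicHLVelocity_neg (L := L) hodd hper (L / 2 - x)
  have h2 := periodicHLVelocity_add_period hL ω (-(L / 2 - x))
  rw [show -(L / 2 - x) + L = L / 2 + x by ring] at h2
  linarith

/-- **Folding over the half period** (display (eqn_u), first two lines): for continuous, odd,
`L`-periodic `ω` and every `x`,
`Qω(x) = (1/π)∫₀^{L/2} ω(y){log|sin μ(x−y)| − log|sin μ(x+y)|} dy` (substitute `y ↦ L − y` on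
`[½L, L]`). [cite: ChoiHouKiselevLuoSverakYao2017, §4 Lemma 6 (eqn_u)] -/
theorem periodicHLVelocity_eq_half {L : ℝ} (hL : 0 < L) {ω : ℝ → ℝ} (hω : Continuous ω)
    (hodd : ∀ y, ω (-y) = -ω y) (hper : Function.Periodic ω L) (x : ℝ) :
    periodicHLVelocity L ω x = 1 / π * ∫ y in (0 : ℝ)..L / 2,
      ω y * (Real.log |Real.sin (π * (x - y) / L)| - Real.log |Real.sin (π * (x + y) / L)|) := by
  unfold periodicHLVelocity
  congr 1
  have hint : ∀ a b : ℝ, IntervalIntegrable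
      (fun y : ℝ => ω y * Real.log |Real.sin (π * (x - y) / L)|) volume a b :=
    fun a b => intervalIntegrable_mul_log_abs_sin_sub hω L x a b
  rw [← intervalIntegral.integral_add_adjacent_intervals (hint 0 (L / 2)) (hint (L / 2) L)]
  -- the second piece, after `y ↦ L − z`
  have h2 : (∫ z in (0 : ℝ)..L / 2, ω (L - z) * Real.log |Real.sin (π * (x - (L - z)) / L)|) =
      ∫ y in L / 2..L, ω y * Real.log |Real.sin (π * (x - y) / L)| := by
    rw [intervalIntegral.integral_comp_sub_left
      (fun y => ω y * Real.log |Real.sin (π * (x - y) / L)|) L]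
    congr 1 <;> ring
  have h3 : (∫ z in (0 : ℝ)..L / 2, ω (L - z) * Real.log |Real.sin (π * (x - (L - z)) / L)|) =
      ∫ z in (0 : ℝ)..L / 2, -(ω z * Real.log |Real.sin (π * (x + z) / L)|) := by
    refine intervalIntegral.integral_congr fun z _ => ?_
    have hω' : ω (L - z) = -ω z := by
      rw [show L - z = -z + L by ring, hper, hodd]
    have h : π * (x - (L - z)) / L = π * (x + z) / L - π := by
      field_simp
      ring
    simp only [hω', h, Real.sin_sub_pi, abs_neg, neg_mul]
  rw [← h2, h3, intervalIntegral.integral_neg, ← sub_eq_add_neg,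
    ← intervalIntegral.integral_sub (hint 0 (L / 2)) (intervalIntegrable_mul_log_abs_sin_add hω L x _ _)]
  refine intervalIntegral.integral_congr fun y _ => ?_
  simp only [mul_sub]

/-! ### §5 Lemma 6: the representation `u(x)cot(μx) = −(1/π)∫₀^{L/2} K(x,y) ω(y) cot(μy) dy` -/

/-- The tangent identity behind Lemma 6 (display (eqn_u), third line, multiplied by `cot a`):
for `a, b ∈ (0, π/2)`, `a ≠ b`, with `s = tan b / tan a`,
`(log sin(a−b) − log sin(a+b))·cot a = −φ(s)·cot b`
(`sin(a∓b) = cos a cos b (tan a ∓ tan b)`, `(tan a − tan b)/(tan a + tan b) = −((s+1)/(s−1))⁻¹`,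
`cot a = s·cot b`; Lean's `log` is even). [cite: ChoiHouKiselevLuoSverakYao2017, §4 Lemma 6 (eqn_u)–(eqn_u_ker)] -/
theorem log_sin_sub_sub_log_sin_add_mul_cot {a b : ℝ} (ha : a ∈ Ioo 0 (π / 2))
    (hb : b ∈ Ioo 0 (π / 2)) (hab : a ≠ b) :
    (Real.log (Real.sin (a - b)) - Real.log (Real.sin (a + b))) * Real.cot a =
      -hlKernelFn (Real.tan b / Real.tan a) * Real.cot b := by
  have hca : 0 < Real.cos a := Real.cos_pos_of_mem_Ioo ⟨by linarith [ha.1, Real.pi_pos], ha.2⟩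
  have hcb : 0 < Real.cos b := Real.cos_pos_of_mem_Ioo ⟨by linarith [hb.1, Real.pi_pos], hb.2⟩
  have hsa : 0 < Real.sin a := Real.sin_pos_of_pos_of_lt_pi ha.1 (by linarith [ha.2, Real.pi_pos])
  have hsb : 0 < Real.sin b := Real.sin_pos_of_pos_of_lt_pi hb.1 (by linarith [hb.2, Real.pi_pos])
  have hta : 0 < Real.tan a := Real.tan_pos_of_pos_of_lt_pi_div_two ha.1 ha.2
  have htb : 0 < Real.tan b := Real.tan_pos_of_pos_of_lt_pi_div_two hb.1 hb.2
  have htab : Real.tan a ≠ Real.tan b := fun h =>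
    hab (Real.tan_inj_of_lt_of_lt_pi_div_two (by linarith [ha.1, Real.pi_pos]) ha.2
      (by linarith [hb.1, Real.pi_pos]) hb.2 h)
  have hsub : Real.sin (a - b) = Real.cos a * Real.cos b * (Real.tan a - Real.tan b) := by
    rw [Real.sin_sub, Real.tan_eq_sin_div_cos, Real.tan_eq_sin_div_cos]
    field_simp
  have hadd : Real.sin (a + b) = Real.cos a * Real.cos b * (Real.tan a + Real.tan b) := by
    rw [Real.sin_add, Real.tan_eq_sin_div_cos, Real.tan_eq_sin_div_cos]
    field_simp
  have hcc : Real.cos a * Real.cos b ≠ 0 := (mul_pos hca hcb).ne'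
  have hd : Real.tan a - Real.tan b ≠ 0 := sub_ne_zero.2 htab
  have hs : Real.tan a + Real.tan b ≠ 0 := (add_pos hta htb).ne'
  set s : ℝ := Real.tan b / Real.tan a with hs_def
  have hs0 : 0 < s := div_pos htb hta
  have hs1 : s - 1 ≠ 0 := by
    intro h
    have : s = 1 := by linarith
    rw [hs_def, div_eq_one_iff_eq hta.ne'] at this
    exact htab this.symm
  have hratio : (Real.tan a - Real.tan b) / (Real.tan a + Real.tan b) = -((s + 1) / (s - 1))⁻¹ := by
    have hba : Real.tan b - Real.tan a ≠ 0 := sub_ne_zero.2 htab.symm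
    have hta0 : Real.tan a ≠ 0 := hta.ne'
    rw [hs_def, inv_div, div_add_one hta0, div_sub_one hta0, div_div_div_cancel_right₀ hta0,
      neg_div', neg_sub, add_comm]
  have hlog : Real.log (Real.sin (a - b)) - Real.log (Real.sin (a + b)) =
      -Real.log ((s + 1) / (s - 1)) := by
    rw [hsub, hadd, Real.log_mul hcc hd, Real.log_mul hcc hs, add_sub_add_left_eq_sub,
      ← Real.log_div hd hs, hratio, Real.log_neg_eq_log, Real.log_inv]
  have hcot : Real.cot a = s * Real.cot b := by
    rw [hs_def, Real.cot_eq_cos_div_sin, Real.cot_eq_cos_div_sin, Real.tan_eq_sin_div_cos,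
      Real.tan_eq_sin_div_cos]
    field_simp
  rw [hlog, hcot, hlKernelFn]
  ring

/-- The pointwise identity behind the representation: for `x, y ∈ (0, ½L)`, `y ≠ x`,
`ω(y)·{log|sin μ(x−y)| − log|sin μ(x+y)|}·cot(μx) = −K(x,y)·ω(y)·cot(μy)`.
[cite: ChoiHouKiselevLuoSverakYao2017, §4 Lemma 6 (eqn_u)–(eqn_u_ker)] -/
theorem kernelIntegrand_eq {L : ℝ} (hL : 0 < L) (ω : ℝ → ℝ) {x y : ℝ} (hx : x ∈ Ioo 0 (L / 2))
    (hy : y ∈ Ioo 0 (L / 2)) (hyx : y ≠ x) :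
    ω y * (Real.log |Real.sin (π * (x - y) / L)| - Real.log |Real.sin (π * (x + y) / L)|) *
        Real.cot (π * x / L) = -(hlKernel L x y * (ω y * Real.cot (π * y / L))) := by
  have ha := phase_mem_Ioo hL hx
  have hb := phase_mem_Ioo hL hy
  have hab : π * x / L ≠ π * y / L := by
    intro h
    rw [div_left_inj' hL.ne', mul_right_inj' Real.pi_pos.ne'] at h
    exact hyx h.symm
  have key := log_sin_sub_sub_log_sin_add_mul_cot ha hb hab
  rw [show π * x / L - π * y / L = π * (x - y) / L by ring,
    show π * x / L + π * y / L = π * (x + y) / L by ring] at key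
  simp only [Real.log_abs]
  rw [hlKernel, hlRatio, mul_assoc, key]
  ring

/-- Off the two points `y = x`, `y = ½L` of the half period, almost every `y` satisfies the
pointwise identity — the form used under the integral sign. [folklore] -/
private theorem ae_ne_two (x c : ℝ) : ∀ᵐ y ∂(volume : Measure ℝ), y ≠ x ∧ y ≠ c := by
  have h1 : ∀ᵐ y ∂(volume : Measure ℝ), y ≠ x := by
    rw [ae_iff]; simp
  have h2 : ∀ᵐ y ∂(volume : Measure ℝ), y ≠ c := by
    rw [ae_iff]; simp
  filter_upwards [h1, h2] with y h1 h2 using ⟨h1, h2⟩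

/-- **The kernel integrand `y ↦ K(x,y) ω(y) cot(μy)` is integrable on `[0, ½L]`** for continuous `ω`
and `x ∈ (0, ½L)` (its logarithmic singularity at `y = x` is that of the integrand of `Qω`, to which
it is a.e. proportional by `kernelIntegrand_eq`). [cite: ChoiHouKiselevLuoSverakYao2017, §4 Lemma 6 (eqn_u_ker)] -/
theorem intervalIntegrable_kernelIntegrand {L : ℝ} (hL : 0 < L) {ω : ℝ → ℝ} (hω : Continuous ω)
    {x : ℝ} (hx : x ∈ Ioo 0 (L / 2)) :
    IntervalIntegrable (fun y => hlKernel L x y * (ω y * Real.cot (π * y / L))) volume 0 (L / 2) := by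
  have h1 := intervalIntegrable_mul_log_abs_sin_sub hω L x 0 (L / 2)
  have h2 := intervalIntegrable_mul_log_abs_sin_add hω L x 0 (L / 2)
  have h3 : IntervalIntegrable (fun y => -(ω y * (Real.log |Real.sin (π * (x - y) / L)| -
      Real.log |Real.sin (π * (x + y) / L)|) * Real.cot (π * x / L))) volume 0 (L / 2) := by
    have h := ((h1.sub h2).mul_const (Real.cot (π * x / L))).neg
    refine h.congr fun y _ => ?_
    simp only [Pi.neg_apply]
    ring
  refine h3.congr_ae ?_
  have hmem := ae_restrict_mem (μ := (volume : Measure ℝ)) (measurableSet_uIoc (a := 0) (b := L / 2))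
  filter_upwards [hmem, ae_restrict_of_ae (ae_ne_two x (L / 2))] with y hyI hy
  rw [uIoc_of_le (by linarith : (0 : ℝ) ≤ L / 2)] at hyI
  have hyo : y ∈ Ioo 0 (L / 2) := ⟨hyI.1, lt_of_le_of_ne hyI.2 hy.2⟩
  rw [kernelIntegrand_eq hL ω hx hyo hy.1, neg_neg]

/-- **Lemma 6, the representation** (eqn_u_ker): for `0 < L`, continuous odd `L`-periodic `ω`,
`u = Qω` and `x ∈ (0, ½L)`,
`u(x)·cot(μx) = −(1/π) ∫₀^{L/2} K(x,y) ω(y) cot(μy) dy`, `μ = π/L`.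
(Printed "for any `x ∈ [0, ½L]`"; at `x = 0, ½L` both sides are `0` — `u(0) = u(½L) = 0`,
`periodicHLVelocity_zero_pt` / `periodicHLVelocity_half`.) [cite: ChoiHouKiselevLuoSverakYao2017, §4 Lemma 6 (eqn_u_ker)] -/
theorem periodicHLVelocity_mul_cot {L : ℝ} (hL : 0 < L) {ω : ℝ → ℝ} (hω : Continuous ω)
    (hodd : ∀ y, ω (-y) = -ω y) (hper : Function.Periodic ω L) {x : ℝ} (hx : x ∈ Ioo 0 (L / 2)) :
    periodicHLVelocity L ω x * Real.cot (π * x / L) =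
      -(1 / π) * ∫ y in (0 : ℝ)..L / 2, hlKernel L x y * (ω y * Real.cot (π * y / L)) := by
  rw [periodicHLVelocity_eq_half hL hω hodd hper x, mul_assoc, ← intervalIntegral.integral_mul_const,
    neg_mul, ← mul_neg, ← intervalIntegral.integral_neg]
  congr 1
  refine intervalIntegral.integral_congr_ae ?_
  filter_upwards [ae_ne_two x (L / 2)] with y hy hyI
  rw [uIoc_of_le (by linarith : (0 : ℝ) ≤ L / 2)] at hyI
  have hyo : y ∈ Ioo 0 (L / 2) := ⟨hyI.1, lt_of_le_of_ne hyI.2 hy.2⟩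
  exact kernelIntegrand_eq hL ω hx hyo hy.1

/-! ### §6 Consequences of Lemma 6 printed on p. 11–12: the sign law and the CKY comparison -/

/-- `cot(μy) ≥ 0` for `y ∈ [0, ½L]` (junk value `0` at `y = 0`). [folklore] -/
private theorem cot_phase_nonneg {L y : ℝ} (hL : 0 < L) (hy : y ∈ Icc 0 (L / 2)) :
    0 ≤ Real.cot (π * y / L) := by
  have h := phase_mem_Icc hL hy
  rw [Real.cot_eq_cos_div_sin]
  exact div_nonneg (Real.cos_nonneg_of_mem_Icc ⟨by linarith [h.1, Real.pi_pos], h.2⟩)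
    (Real.sin_nonneg_of_nonneg_of_le_pi h.1 (by linarith [h.2, Real.pi_pos]))

/-- `cot(μx) > 0` for `x ∈ (0, ½L)`. [folklore] -/
private theorem cot_phase_pos {L x : ℝ} (hL : 0 < L) (hx : x ∈ Ioo 0 (L / 2)) :
    0 < Real.cot (π * x / L) := by
  have h := phase_mem_Ioo hL hx
  rw [Real.cot_eq_cos_div_sin]
  exact div_pos (Real.cos_pos_of_mem_Ioo ⟨by linarith [h.1, Real.pi_pos], h.2⟩)
    (Real.sin_pos_of_pos_of_lt_pi h.1 (by linarith [h.2, Real.pi_pos]))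

/-- The kernel integrand is nonnegative on `[0, ½L]` when `ω ≥ 0` there. [cite: ChoiHouKiselevLuoSverakYao2017, §4 p. 11 (u₀ ≤ 0 on [0, ½L])] -/
theorem kernelIntegrand_nonneg {L : ℝ} (hL : 0 < L) {ω : ℝ → ℝ}
    (hnn : ∀ y ∈ Icc 0 (L / 2), 0 ≤ ω y) {x y : ℝ} (hx : x ∈ Ioo 0 (L / 2))
    (hy : y ∈ Icc 0 (L / 2)) : 0 ≤ hlKernel L x y * (ω y * Real.cot (π * y / L)) :=
  mul_nonneg (hlKernel_nonneg hL hx hy) (mul_nonneg (hnn y hy) (cot_phase_nonneg hL hy))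

/-- **The sign law of p. 11**: "we suppose `θ_{0x}, ω₀ ≥ 0` on `[0, ½L]`. Then, the initial velocity
`u₀` also becomes odd at `x = 0` and `½L` and `u₀ ≤ 0` on `[0, ½L]` (for the proof of the last
assertion on `u₀`, see (eqn_u))". For continuous odd `L`-periodic `ω ≥ 0` on `[0, ½L]`:
`Qω ≤ 0` on `[0, ½L]` (Lemma 6: `u·cot(μx) = −(1/π)∫ K ω cot ≤ 0` and `cot(μx) > 0` inside;
`u(0) = u(½L) = 0`). [cite: ChoiHouKiselevLuoSverakYao2017, §4 p. 11 (u₀ ≤ 0 on [0, ½L])] -/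
theorem periodicHLVelocity_nonpos {L : ℝ} (hL : 0 < L) {ω : ℝ → ℝ} (hω : Continuous ω)
    (hodd : ∀ y, ω (-y) = -ω y) (hper : Function.Periodic ω L)
    (hnn : ∀ y ∈ Icc 0 (L / 2), 0 ≤ ω y) {x : ℝ} (hx : x ∈ Icc 0 (L / 2)) :
    periodicHLVelocity L ω x ≤ 0 := by
  rcases eq_or_lt_of_le hx.1 with h0 | h0
  · rw [← h0, periodicHLVelocity_zero_pt hodd hper]
  rcases eq_or_lt_of_le hx.2 with h2 | h2
  · rw [h2, periodicHLVelocity_half hL.ne' hodd hper]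
  have hxo : x ∈ Ioo 0 (L / 2) := ⟨h0, h2⟩
  have hrep := periodicHLVelocity_mul_cot hL hω hodd hper hxo
  have hint : 0 ≤ ∫ y in (0 : ℝ)..L / 2, hlKernel L x y * (ω y * Real.cot (π * y / L)) :=
    intervalIntegral.integral_nonneg (by linarith) fun y hy => kernelIntegrand_nonneg hL hnn hxo hy
  have hcot := cot_phase_pos hL hxo
  have hprod : periodicHLVelocity L ω x * Real.cot (π * x / L) ≤ 0 := by
    rw [hrep, neg_mul]
    exact neg_nonpos.2 (mul_nonneg (by positivity) hint)
  by_contra h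
  push Not at h
  linarith [mul_pos h hcot]

/-- `cos(T)/t ≤ cot t` for `0 < t ≤ T ≤ π/2` (`sin t ≤ t`, `cos` decreasing on `[0, π]`). [folklore] -/
private theorem cos_div_le_cot {t T : ℝ} (ht : 0 < t) (htT : t ≤ T) (hT : T ≤ π / 2) :
    Real.cos T / t ≤ Real.cot t := by
  have hsin : 0 < Real.sin t := Real.sin_pos_of_pos_of_lt_pi ht (by linarith [Real.pi_pos])
  have hcos : 0 ≤ Real.cos t :=
    Real.cos_nonneg_of_mem_Icc ⟨by linarith [Real.pi_pos], htT.trans hT⟩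
  rw [Real.cot_eq_cos_div_sin]
  calc Real.cos T / t ≤ Real.cos t / t :=
        div_le_div_of_nonneg_right
          (Real.cos_le_cos_of_nonneg_of_le_pi ht.le (by linarith [Real.pi_pos]) htT) ht.le
    _ ≤ Real.cos t / Real.sin t := div_le_div_of_nonneg_left hcos hsin (Real.sin_le ht.le)

/-- **The CKY comparison** (Remark after Lemma 6, p. 12, with an explicit constant): for continuous
odd `L`-periodic `ω ≥ 0` on `[0, ½L]`, `z ∈ (0, ½L)` and `x ∈ [0, z]`,
`u_HL(x) ≤ −C·x·∫_x^z ω(y)/y dy` with `C = 2cos(μz)/π`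
("`u_HL(x) ≤ −Cx∫_x^z (1/y)ω(y)dy ∀x ∈ [0,z]`", `C` "depending on `L` and `z`"; from Lemma 6 (a)/(b):
`−u·cot(μx) ≥ (2/π)∫_x^z ω cot(μy) dy`, `cot(μy) ≥ cos(μz)/(μy)` on `(0, z]`, `tan(μx) ≥ μx`).
[cite: ChoiHouKiselevLuoSverakYao2017, §4 Remark after Lemma 6 (u_HL vs u_CKY)] -/
theorem periodicHLVelocity_le_cky {L : ℝ} (hL : 0 < L) {ω : ℝ → ℝ} (hω : Continuous ω)
    (hodd : ∀ y, ω (-y) = -ω y) (hper : Function.Periodic ω L)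
    (hnn : ∀ y ∈ Icc 0 (L / 2), 0 ≤ ω y) {z : ℝ} (hz : z ∈ Ioo 0 (L / 2)) {x : ℝ}
    (hx : x ∈ Icc 0 z) :
    periodicHLVelocity L ω x ≤
      -(2 * Real.cos (π * z / L) / π) * x * ∫ y in x..z, ω y / y := by
  rcases eq_or_lt_of_le hx.1 with h0 | h0
  · rw [← h0, periodicHLVelocity_zero_pt hodd hper]
    simp
  have hxo : x ∈ Ioo 0 (L / 2) := ⟨h0, lt_of_le_of_lt hx.2 hz.2⟩
  have hxz : x ≤ z := hx.2
  set F : ℝ → ℝ := fun y => hlKernel L x y * (ω y * Real.cot (π * y / L)) with hF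
  have hFint : IntervalIntegrable F volume 0 (L / 2) := intervalIntegrable_kernelIntegrand hL hω hxo
  have hFsub : IntervalIntegrable F volume x z :=
    hFint.mono_set (by
      rw [uIcc_of_le hxz, uIcc_of_le (by linarith : (0 : ℝ) ≤ L / 2)]
      exact Icc_subset_Icc h0.le hz.2.le)
  -- (1) drop `[0, x] ∪ [z, ½L]`
  have h1 : ∫ y in x..z, F y ≤ ∫ y in (0 : ℝ)..L / 2, F y := by
    refine intervalIntegral.integral_mono_interval h0.le hxz hz.2.le ?_ hFint
    refine ae_restrict_of_forall_mem measurableSet_Ioc fun y hy => ?_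
    exact kernelIntegrand_nonneg hL hnn hxo ⟨hy.1.le, hy.2⟩
  -- (2) `K ≥ 2` on `(x, z)` (Lemma 6 (b))
  have hIcc_pos : ∀ y ∈ Icc x z, 0 < y := fun y hy => h0.trans_le hy.1
  have hsin_ne : ∀ y ∈ Icc x z, Real.sin (π * y / L) ≠ 0 := by
    intro y hy
    have hyo : y ∈ Ioo 0 (L / 2) := ⟨hIcc_pos y hy, lt_of_le_of_lt hy.2 hz.2⟩
    have h := phase_mem_Ioo hL hyo
    exact (Real.sin_pos_of_pos_of_lt_pi h.1 (by linarith [h.2, Real.pi_pos])).ne'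
  have hGcont : ContinuousOn (fun y => 2 * (ω y * Real.cot (π * y / L))) (Icc x z) := by
    have hc : ContinuousOn (fun y => 2 * (ω y * (Real.cos (π * y / L) / Real.sin (π * y / L))))
        (Icc x z) := by
      refine continuousOn_const.mul (hω.continuousOn.mul ?_)
      exact ((Real.continuous_cos.comp (by fun_prop)).continuousOn).div
        ((Real.continuous_sin.comp (by fun_prop)).continuousOn) hsin_ne
    refine hc.congr fun y _ => ?_
    simp only [Real.cot_eq_cos_div_sin]
  have hGint : IntervalIntegrable (fun y => 2 * (ω y * Real.cot (π * y / L))) volume x z :=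
    (hGcont.mono (by rw [uIcc_of_le hxz])).intervalIntegrable
  have h2 : ∫ y in x..z, 2 * (ω y * Real.cot (π * y / L)) ≤ ∫ y in x..z, F y := by
    refine intervalIntegral.integral_mono_on_of_le_Ioo hxz hGint hFsub fun y hy => ?_
    have hyo : y ∈ Ioo 0 (L / 2) := ⟨h0.trans hy.1, hy.2.trans hz.2⟩
    exact mul_le_mul_of_nonneg_right (two_le_hlKernel hL hxo hyo hy.1)
      (mul_nonneg (hnn y ⟨hyo.1.le, hyo.2.le⟩) (cot_phase_nonneg hL ⟨hyo.1.le, hyo.2.le⟩))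
  -- (3) `cot(μy) ≥ cos(μz)/(μy)` on `[x, z]`
  set c : ℝ := Real.cos (π * z / L) with hc_def
  have hHcont : ContinuousOn (fun y => 2 * (ω y * (c / (π * y / L)))) (Icc x z) := by
    refine continuousOn_const.mul (hω.continuousOn.mul (continuousOn_const.div (by fun_prop) ?_))
    intro y hy
    exact (div_pos (mul_pos Real.pi_pos (hIcc_pos y hy)) hL).ne'
  have hHint : IntervalIntegrable (fun y => 2 * (ω y * (c / (π * y / L)))) volume x z :=
    (hHcont.mono (by rw [uIcc_of_le hxz])).intervalIntegrable
  have h3 : ∫ y in x..z, 2 * (ω y * (c / (π * y / L))) ≤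
      ∫ y in x..z, 2 * (ω y * Real.cot (π * y / L)) := by
    refine intervalIntegral.integral_mono_on hxz hHint hGint fun y hy => ?_
    have hy0 : 0 < y := hIcc_pos y hy
    have hyL : y ∈ Icc 0 (L / 2) := ⟨hy0.le, hy.2.trans hz.2.le⟩
    refine mul_le_mul_of_nonneg_left (mul_le_mul_of_nonneg_left ?_ (hnn y hyL)) (by norm_num)
    refine cos_div_le_cot (div_pos (mul_pos Real.pi_pos hy0) hL) ?_ ?_
    · exact div_le_div_of_nonneg_right (mul_le_mul_of_nonneg_left hy.2 Real.pi_pos.le) hL.le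
    · exact (phase_mem_Icc hL ⟨hz.1.le, hz.2.le⟩).2
  -- (4) pull the constant
  have h4 : ∫ y in x..z, 2 * (ω y * (c / (π * y / L))) =
      2 * L * c / π * ∫ y in x..z, ω y / y := by
    rw [← intervalIntegral.integral_const_mul]
    refine intervalIntegral.integral_congr fun y hy => ?_
    rw [uIcc_of_le hxz] at hy
    have hy0 : y ≠ 0 := (hIcc_pos y hy).ne'
    field_simp
  -- (5) the CKY integral is nonnegative
  have h5 : 0 ≤ ∫ y in x..z, ω y / y :=
    intervalIntegral.integral_nonneg hxz fun y hy =>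
      div_nonneg (hnn y ⟨(hIcc_pos y hy).le, hy.2.trans hz.2.le⟩) (hIcc_pos y hy).le
  -- (6) assemble with Lemma 6 and `tan(μx) ≥ μx`
  have hrep := periodicHLVelocity_mul_cot hL hω hodd hper hxo
  have hph := phase_mem_Ioo hL hxo
  have htan : 0 < Real.tan (π * x / L) := tan_phase_pos hL hxo
  have hcot_tan : Real.cot (π * x / L) * Real.tan (π * x / L) = 1 := by
    rw [Real.cot_eq_cos_div_sin, Real.tan_eq_sin_div_cos]
    have hs : Real.sin (π * x / L) ≠ 0 :=
      (Real.sin_pos_of_pos_of_lt_pi hph.1 (by linarith [hph.2, Real.pi_pos])).ne'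
    have hc' : Real.cos (π * x / L) ≠ 0 :=
      (Real.cos_pos_of_mem_Ioo ⟨by linarith [hph.1, Real.pi_pos], hph.2⟩).ne'
    field_simp
  have hux : periodicHLVelocity L ω x =
      periodicHLVelocity L ω x * Real.cot (π * x / L) * Real.tan (π * x / L) := by
    rw [mul_assoc, hcot_tan, mul_one]
  set I0 : ℝ := ∫ y in x..z, ω y / y with hI0
  set A : ℝ := 1 / π * (2 * L * c / π * I0) with hA
  have hc0 : 0 ≤ c := Real.cos_nonneg_of_mem_Icc
    ⟨by linarith [(phase_mem_Ioo hL hz).1, Real.pi_pos], (phase_mem_Ioo hL hz).2.le⟩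
  have hA0 : 0 ≤ A := by positivity
  have hchain : A ≤ 1 / π * ∫ y in (0 : ℝ)..L / 2, F y := by
    rw [hA]
    refine mul_le_mul_of_nonneg_left ?_ (by positivity)
    calc 2 * L * c / π * I0 = ∫ y in x..z, 2 * (ω y * (c / (π * y / L))) := h4.symm
      _ ≤ ∫ y in x..z, F y := h3.trans h2
      _ ≤ ∫ y in (0 : ℝ)..L / 2, F y := h1
  have hucot : periodicHLVelocity L ω x * Real.cot (π * x / L) ≤ -A := by
    rw [hrep]
    linarith
  have hμx : π * x / L ≤ Real.tan (π * x / L) := Real.le_tan hph.1.le hph.2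
  calc periodicHLVelocity L ω x
      = periodicHLVelocity L ω x * Real.cot (π * x / L) * Real.tan (π * x / L) := hux
    _ ≤ -A * Real.tan (π * x / L) := mul_le_mul_of_nonneg_right hucot htan.le
    _ ≤ -A * (π * x / L) := by nlinarith
    _ = -(2 * Real.cos (π * z / L) / π) * x * I0 := by
        rw [hA, hc_def]
        field_simp

/-! ### §7 The quadratic-feedback blow-up step (gengron) -/

/-- Interval integrability of `I²` on `[a, b] ⊂ [0, ∞)` for `I` continuous on `[0, ∞)`. [folklore] -/
private theorem sq_intervalIntegrable {I : ℝ → ℝ} (hcont : ContinuousOn I (Ici 0)) {a b : ℝ}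
    (ha : 0 ≤ a) (hb : 0 ≤ b) : IntervalIntegrable (fun s => I s ^ 2) volume a b := by
  refine ((hcont.pow 2).mono ?_).intervalIntegrable
  intro s hs
  rcases le_total a b with hab | hab
  · rw [uIcc_of_le hab] at hs; exact ha.trans hs.1
  · rw [uIcc_of_ge hab] at hs; exact hb.trans hs.1

/-- `F(t) = ∫₀ᵗ I²` has derivative `I(t)²` at every `t > 0`. [folklore] -/
private theorem hasDerivAt_sqPrimitive {I : ℝ → ℝ} (hcont : ContinuousOn I (Ici 0)) {t : ℝ}
    (ht : 0 < t) : HasDerivAt (fun t => ∫ s in (0 : ℝ)..t, I s ^ 2) (I t ^ 2) t := by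
  refine intervalIntegral.integral_hasDerivAt_right (sq_intervalIntegrable hcont le_rfl ht.le) ?_ ?_
  · exact ((hcont.pow 2).mono Ioi_subset_Ici_self).stronglyMeasurableAtFilter isOpen_Ioi _ ht
  · exact ((hcont.continuousWithinAt (mem_Ici.2 ht.le)).continuousAt (Ici_mem_nhds ht)).pow 2

/-- `F(t) = ∫₀ᵗ I²` is continuous on `[0, ∞)`. [folklore] -/
private theorem continuousOn_sqPrimitive {I : ℝ → ℝ} (hcont : ContinuousOn I (Ici 0)) :
    ContinuousOn (fun t => ∫ s in (0 : ℝ)..t, I s ^ 2) (Ici 0) := by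
  intro t ht
  have ht0 : (0 : ℝ) ≤ t := ht
  have hint : IntegrableOn (fun s => I s ^ 2) (uIcc 0 (t + 1)) volume := by
    rw [uIcc_of_le (by linarith : (0 : ℝ) ≤ t + 1)]
    exact ((hcont.pow 2).mono Icc_subset_Ici_self).integrableOn_compact isCompact_Icc
  have hc := intervalIntegral.continuousOn_primitive_interval hint
  have hct : ContinuousWithinAt (fun t => ∫ s in (0 : ℝ)..t, I s ^ 2) (uIcc 0 (t + 1)) t :=
    hc t (by rw [uIcc_of_le (by linarith : (0 : ℝ) ≤ t + 1)]; exact ⟨ht0, by linarith⟩)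
  refine hct.mono_of_mem_nhdsWithin ?_
  rw [uIcc_of_le (by linarith : (0 : ℝ) ≤ t + 1), mem_nhdsWithin]
  exact ⟨Iio (t + 1), isOpen_Iio, by simp, fun y hy => ⟨hy.2, hy.1.le⟩⟩

/-- **The blow-up step (gengron), integrated form.** There is no function `I`, continuous on
`[0, ∞)` and differentiable on `(0, ∞)`, with `I(0) > 0` and
`I′(t) ≥ c₀ ∫₀ᵗ I(s)² ds` for all `t > 0`, where `c₀ > 0`
(CHKLSY p. 13: "`dI/dt ≥ J(0) + c₀∫₀ᵗ I(t)²dt ≥ c₀∫₀ᵗ I(t)²dt` … From this inequality finite time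
blow up can be inferred in a standard way"). Route: with `F = ∫₀ᵗ I²`, `I ≥ I(0) > 0`,
`I³ − (3c₀/2)F²` is nondecreasing, so `F′ = I² ≥ (3c₀/2)^{2/3}F^{4/3}` and `F^{−1/3}` decreases at
the fixed rate `(3c₀/2)^{2/3}/3` on `[1, ∞)`, which a positive function cannot do for ever.
[cite: ChoiHouKiselevLuoSverakYao2017, §4 proof of Thm 1 (gengron)] -/
theorem not_global_of_quadratic_feedback {I I' : ℝ → ℝ} {c₀ : ℝ} (hc : 0 < c₀) (hI0 : 0 < I 0)
    (hcont : ContinuousOn I (Ici 0)) (hderiv : ∀ t, 0 < t → HasDerivAt I (I' t) t)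
    (hineq : ∀ t, 0 < t → c₀ * (∫ s in (0 : ℝ)..t, I s ^ 2) ≤ I' t) : False := by
  set F : ℝ → ℝ := fun t => ∫ s in (0 : ℝ)..t, I s ^ 2 with hF
  have hFderiv : ∀ t, 0 < t → HasDerivAt F (I t ^ 2) t := fun t ht => hasDerivAt_sqPrimitive hcont ht
  have hFcont : ContinuousOn F (Ici 0) := continuousOn_sqPrimitive hcont
  have hF0 : F 0 = 0 := by simp [hF]
  have hFnn : ∀ t, 0 ≤ t → 0 ≤ F t := fun t ht =>
    intervalIntegral.integral_nonneg ht fun s _ => sq_nonneg _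
  -- (i) `I` is nondecreasing, `I ≥ I(0) > 0`
  have hImono : MonotoneOn I (Ici 0) := by
    refine monotoneOn_of_deriv_nonneg (convex_Ici 0) hcont ?_ ?_
    · rw [interior_Ici]
      exact fun t ht => (hderiv t ht).differentiableAt.differentiableWithinAt
    · rw [interior_Ici]
      intro t ht
      rw [(hderiv t ht).deriv]
      exact le_trans (mul_nonneg hc.le (hFnn t (le_of_lt ht))) (hineq t ht)
  have hIpos : ∀ t, 0 ≤ t → 0 < I t := fun t ht =>
    hI0.trans_le (hImono (mem_Ici.2 le_rfl) (mem_Ici.2 ht) ht)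
  -- (ii) `F > 0` on `(0, ∞)`
  have hFpos : ∀ t, 0 < t → 0 < F t := by
    intro t ht
    exact intervalIntegral.intervalIntegral_pos_of_pos_on (sq_intervalIntegrable hcont le_rfl ht.le)
      (fun s hs => pow_pos (hIpos s hs.1.le) 2) ht
  -- (iii) `H = I³ − (3c₀/2) F²` is nondecreasing, hence `I³ ≥ (3c₀/2) F²`
  have hHmono : MonotoneOn (fun t => I t ^ 3 - 3 * c₀ / 2 * F t ^ 2) (Ici 0) := by
    have hHd : ∀ t, 0 < t → HasDerivAt (fun t => I t ^ 3 - 3 * c₀ / 2 * F t ^ 2)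
        (↑(3 : ℕ) * I t ^ (3 - 1) * I' t - 3 * c₀ / 2 * (↑(2 : ℕ) * F t ^ (2 - 1) * I t ^ 2)) t :=
      fun t ht => ((hderiv t ht).pow 3).sub (((hFderiv t ht).pow 2).const_mul _)
    refine monotoneOn_of_deriv_nonneg (convex_Ici 0)
      ((hcont.pow 3).sub ((hFcont.pow 2).const_mul _)) ?_ ?_
    · rw [interior_Ici]
      exact fun t ht => (hHd t ht).differentiableAt.differentiableWithinAt
    · rw [interior_Ici]
      intro t ht
      rw [(hHd t ht).deriv]
      have h1 := hineq t ht
      have h2 : 0 ≤ I t ^ 2 := sq_nonneg _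
      push_cast
      nlinarith
  have hcube : ∀ t, 0 < t → 3 * c₀ / 2 * F t ^ 2 ≤ I t ^ 3 := by
    intro t ht
    have h := hHmono (mem_Ici.2 le_rfl) (mem_Ici.2 ht.le) ht.le
    simp only [hF0] at h
    have h3 : 0 < I 0 ^ 3 := pow_pos hI0 3
    linarith
  -- (iv) `I² ≥ k F^{4/3}`, `k = (3c₀/2)^{2/3}`
  set k : ℝ := (3 * c₀ / 2) ^ ((2 : ℝ) / 3) with hk
  have hk0 : 0 < k := Real.rpow_pos_of_pos (by positivity) _
  have hkey : ∀ t, 0 < t → k * F t ^ ((4 : ℝ) / 3) ≤ I t ^ 2 := by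
    intro t ht
    have hIt := hIpos t ht.le
    have hFt := (hFpos t ht).le
    set b : ℝ := 3 * c₀ / 2 * F t ^ 2 with hb
    have hb0 : 0 ≤ b := by positivity
    have h13 : b ^ ((1 : ℝ) / 3) ≤ I t := by
      have h := Real.rpow_le_rpow hb0 (hcube t ht) (by norm_num : (0 : ℝ) ≤ 1 / 3)
      rwa [← Real.rpow_natCast (I t) 3, ← Real.rpow_mul hIt.le,
        show ((3 : ℕ) : ℝ) * (1 / 3) = 1 by norm_num, Real.rpow_one] at h
    have h23 : b ^ ((2 : ℝ) / 3) ≤ I t ^ 2 := by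
      have h := pow_le_pow_left₀ (Real.rpow_nonneg hb0 _) h13 2
      rwa [← Real.rpow_natCast (b ^ ((1 : ℝ) / 3)) 2, ← Real.rpow_mul hb0,
        show (1 : ℝ) / 3 * ((2 : ℕ) : ℝ) = 2 / 3 by norm_num] at h
    have hsplit : b ^ ((2 : ℝ) / 3) = k * F t ^ ((4 : ℝ) / 3) := by
      rw [hb, Real.mul_rpow (by positivity) (by positivity), hk,
        ← Real.rpow_natCast (F t) 2, ← Real.rpow_mul hFt,
        show ((2 : ℕ) : ℝ) * ((2 : ℝ) / 3) = 4 / 3 by norm_num]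
    rw [← hsplit]
    exact h23
  -- (v) `G = F^{−1/3}` decreases at rate `k/3` on `[1, ∞)`
  set G : ℝ → ℝ := fun t => F t ^ (-(1 / 3 : ℝ)) with hG
  have hGd : ∀ t, 0 < t → HasDerivAt G (I t ^ 2 * (-(1 / 3 : ℝ)) * F t ^ (-(1 / 3 : ℝ) - 1)) t :=
    fun t ht => (hFderiv t ht).rpow_const (Or.inl (hFpos t ht).ne')
  have hGle : ∀ t, 0 < t → I t ^ 2 * (-(1 / 3 : ℝ)) * F t ^ (-(1 / 3 : ℝ) - 1) ≤ -(k / 3) := by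
    intro t ht
    have hFt := hFpos t ht
    have hpow : F t ^ ((4 : ℝ) / 3) * F t ^ (-(1 / 3 : ℝ) - 1) = 1 := by
      rw [← Real.rpow_add hFt, show (4 : ℝ) / 3 + (-(1 / 3 : ℝ) - 1) = 0 by norm_num, Real.rpow_zero]
    have hneg : 0 < F t ^ (-(1 / 3 : ℝ) - 1) := Real.rpow_pos_of_pos hFt _
    have h := mul_le_mul_of_nonneg_right (hkey t ht) hneg.le
    rw [mul_assoc, hpow, mul_one] at h
    nlinarith
  have hGcont : ContinuousOn G (Ici 1) := by
    refine (hFcont.mono (Ici_subset_Ici.2 zero_le_one)).rpow_const ?_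
    intro t ht; exact Or.inl (hFpos t (lt_of_lt_of_le one_pos ht)).ne'
  have hGdiff : DifferentiableOn ℝ G (interior (Ici 1)) := by
    rw [interior_Ici]
    exact fun t ht => (hGd t (one_pos.trans ht)).differentiableAt.differentiableWithinAt
  have hGderiv_le : ∀ t ∈ interior (Ici (1 : ℝ)), deriv G t ≤ -(k / 3) := by
    rw [interior_Ici]
    intro t ht
    rw [(hGd t (one_pos.trans ht)).deriv]
    exact hGle t (one_pos.trans ht)
  have hslope := (convex_Ici (1 : ℝ)).image_sub_le_mul_sub_of_deriv_le hGcont hGdiff hGderiv_le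
  set T : ℝ := 1 + 3 * (G 1 + 1) / k with hT
  have hT1 : 1 ≤ T := by
    have : 0 ≤ 3 * (G 1 + 1) / k :=
      div_nonneg (by nlinarith [Real.rpow_pos_of_pos (hFpos 1 one_pos) (-(1 / 3 : ℝ))]) hk0.le
    linarith
  have h := hslope 1 (mem_Ici.2 le_rfl) T (mem_Ici.2 hT1) hT1
  have hGT : 0 < G T := Real.rpow_pos_of_pos (hFpos T (one_pos.trans_le hT1)) _
  have hcalc : -(k / 3) * (T - 1) = -(G 1 + 1) := by
    rw [hT]
    field_simp
    ring
  rw [hcalc] at h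
  linarith

/-- **The blow-up step (gengron), two-function form** — the shape in which §4 proves Theorem 1:
no pair `I, J`, continuous on `[0, ∞)` and differentiable on `(0, ∞)`, satisfies `I(0) > 0`,
`J(0) ≥ 0`, `I′ ≥ J` and `J′ ≥ c₀ I²` on `(0, ∞)` with `c₀ > 0` (p. 13: "`d/dt I(t) ≥ … =: J(t)`",
"`dJ/dt ≥ (2/L²) I²`", "(gengron)"). Reduction: `J − c₀∫₀ᵗ I²` is nondecreasing, so
`I′ ≥ J ≥ J(0) + c₀∫₀ᵗ I² ≥ c₀∫₀ᵗ I²`, and `not_global_of_quadratic_feedback` applies.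
[cite: ChoiHouKiselevLuoSverakYao2017, §4 proof of Thm 1 (gengron)] -/
theorem not_global_of_quadratic_feedback₂ {I I' J J' : ℝ → ℝ} {c₀ : ℝ} (hc : 0 < c₀)
    (hI0 : 0 < I 0) (hJ0 : 0 ≤ J 0) (hIc : ContinuousOn I (Ici 0)) (hJc : ContinuousOn J (Ici 0))
    (hId : ∀ t, 0 < t → HasDerivAt I (I' t) t) (hJd : ∀ t, 0 < t → HasDerivAt J (J' t) t)
    (hIJ : ∀ t, 0 < t → J t ≤ I' t) (hJI : ∀ t, 0 < t → c₀ * I t ^ 2 ≤ J' t) : False := by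
  set F : ℝ → ℝ := fun t => ∫ s in (0 : ℝ)..t, I s ^ 2 with hF
  have hFderiv : ∀ t, 0 < t → HasDerivAt F (I t ^ 2) t := fun t ht => hasDerivAt_sqPrimitive hIc ht
  have hFcont : ContinuousOn F (Ici 0) := continuousOn_sqPrimitive hIc
  have hF0 : F 0 = 0 := by simp [hF]
  -- `J − c₀ F` is nondecreasing on `[0, ∞)`
  have hKmono : MonotoneOn (fun t => J t - c₀ * F t) (Ici 0) := by
    have hKd : ∀ t, 0 < t → HasDerivAt (fun t => J t - c₀ * F t) (J' t - c₀ * I t ^ 2) t :=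
      fun t ht => (hJd t ht).sub ((hFderiv t ht).const_mul c₀)
    refine monotoneOn_of_deriv_nonneg (convex_Ici 0) (hJc.sub (hFcont.const_mul c₀)) ?_ ?_
    · rw [interior_Ici]
      exact fun t ht => (hKd t ht).differentiableAt.differentiableWithinAt
    · rw [interior_Ici]
      intro t ht
      rw [(hKd t ht).deriv]
      linarith [hJI t ht]
  refine not_global_of_quadratic_feedback hc hI0 hIc hId fun t ht => ?_
  have h := hKmono (mem_Ici.2 le_rfl) (mem_Ici.2 ht.le) ht.le
  simp only [hF0, mul_zero, sub_zero] at h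
  have h' : c₀ * F t ≤ J t := by linarith
  exact h'.trans (hIJ t ht)

/-! ### §8 The kernel algebra of Lemma 7: `φ′`, `G = K_x`, the symmetrised kernel `T ≤ 0` -/

/-- **`φ′(s) = log((s+1)/(s−1)) − 2s/(s²−1)`**, the derivative of `φ(s) = s log((s+1)/(s−1))` off
`s = ±1` (so that `K_x = φ′(s)·s_x`; p. 12 display for `G = K_x`).
[cite: ChoiHouKiselevLuoSverakYao2017, §4 proof of Lemma 7, p. 12 (G = K_x)] -/
def hlKernelFnDeriv (s : ℝ) : ℝ := Real.log ((s + 1) / (s - 1)) - 2 * s / (s ^ 2 - 1)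

/-- `φ` has derivative `φ′` off `s = ±1`. [cite: ChoiHouKiselevLuoSverakYao2017, §4 proof of Lemma 7, p. 12 (G = K_x)] -/
theorem hasDerivAt_hlKernelFn_deriv {s : ℝ} (h1 : s ≠ 1) (h2 : s ≠ -1) :
    HasDerivAt hlKernelFn (hlKernelFnDeriv s) s :=
  hasDerivAt_hlKernelFn h1 h2

/-- `φ′` in absolute-value form: `φ′(s) = log|(s+1)/(s−1)| − 2s/(s²−1)`. [cite: ChoiHouKiselevLuoSverakYao2017, §4 proof of Lemma 7, p. 12 (G = K_x)] -/
theorem hlKernelFnDeriv_eq_abs (s : ℝ) :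
    hlKernelFnDeriv s = Real.log |(s + 1) / (s - 1)| - 2 * s / (s ^ 2 - 1) := by
  rw [hlKernelFnDeriv, Real.log_abs]

/-- The reflection `s ↦ 1/s`: `φ′(1/s) = log|(s+1)/(s−1)| + 2s/(s²−1)` for `s ≠ 0, ±1` — the
second summand of `T(x,y)` (`s(y,x) = 1/s(x,y)`). [cite: ChoiHouKiselevLuoSverakYao2017, §4 proof of Lemma 7, p. 12 (T(x,y))] -/
theorem hlKernelFnDeriv_inv {s : ℝ} (h0 : s ≠ 0) (h1 : s ≠ 1) (h2 : s ≠ -1) :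
    hlKernelFnDeriv (1 / s) = Real.log |(s + 1) / (s - 1)| + 2 * s / (s ^ 2 - 1) := by
  rw [hlKernelFnDeriv_eq_abs]
  have hs1 : s - 1 ≠ 0 := sub_ne_zero.2 h1
  have hs2 : s + 1 ≠ 0 := fun h => h2 (by linarith)
  have hs3 : 1 - s ≠ 0 := fun h => h1 (by linarith)
  have h4 : s ^ 2 - 1 ≠ 0 := by
    have : s ^ 2 - 1 = (s + 1) * (s - 1) := by ring
    rw [this]; exact mul_ne_zero hs2 hs1
  have h5 : 1 - s ^ 2 ≠ 0 := by
    have : 1 - s ^ 2 = (1 - s) * (1 + s) := by ring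
    rw [this]; exact mul_ne_zero hs3 (fun h => hs2 (by linarith))
  have hratio : (1 / s + 1) / (1 / s - 1) = -((s + 1) / (s - 1)) := by
    field_simp
    ring
  have hfrac : 2 * (1 / s) / ((1 / s) ^ 2 - 1) = -(2 * s / (s ^ 2 - 1)) := by
    have h6 : (1 / s) ^ 2 - 1 = (1 - s ^ 2) / s ^ 2 := by field_simp
    rw [h6]
    field_simp
    ring
  rw [hratio, abs_neg, hfrac]
  ring

/-- **`log|(s+1)/(s−1)| ≥ 2s/(s²+1)` for `s ≥ 0`, `s ≠ 1`** (p. 12: "Thanks to Lemma 6 (b) and (c),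
we have `K(x,y) ≥ 2s²/(s²+1)` for all `s ≥ 0`, which implies that
`log|(s+1)/(s−1)| ≥ 2s/(s²+1)`"). [cite: ChoiHouKiselevLuoSverakYao2017, §4 proof of Lemma 7, p. 12 (log|(s+1)/(s−1)| ≥ 2s/(s²+1))] -/
theorem two_mul_div_le_log_ratio {s : ℝ} (hs : 0 ≤ s) (h1 : s ≠ 1) :
    2 * s / (s ^ 2 + 1) ≤ Real.log |(s + 1) / (s - 1)| := by
  rcases eq_or_lt_of_le hs with h0 | h0
  · rw [← h0]; norm_num
  -- `K = s·log|…| ≥ 2s²/(s²+1)` from Lemma 6 (b), (c); divide by `s > 0`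
  have hK : 2 * s ^ 2 / (s ^ 2 + 1) ≤ hlKernelFn s := by
    rcases lt_or_gt_of_ne h1 with hlt | hgt
    · have h := two_mul_sq_le_hlKernelFn ⟨h0, hlt⟩
      refine le_trans ?_ h
      rw [div_le_iff₀ (by positivity)]
      nlinarith [sq_nonneg s]
    · have h := two_le_hlKernelFn hgt
      refine le_trans ?_ h
      rw [div_le_iff₀ (by positivity)]
      nlinarith [sq_nonneg s]
  rw [hlKernelFn_eq_abs] at hK
  rw [show 2 * s / (s ^ 2 + 1) = (2 * s ^ 2 / (s ^ 2 + 1)) / s by field_simp]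
  rw [div_le_iff₀ h0]
  linarith

/-- **`∂ₓ s(x,y) = −μ tan(μy)/sin²(μx)`** for `x ∈ (0, ½L)` (`s = tan(μy)/tan(μx)`, `μ = π/L`).
[cite: ChoiHouKiselevLuoSverakYao2017, §4 proof of Lemma 7, p. 12 (G = K_x)] -/
theorem hasDerivAt_hlRatio_left {L x : ℝ} (hL : 0 < L) (hx : x ∈ Ioo 0 (L / 2)) (y : ℝ) :
    HasDerivAt (fun x => hlRatio L x y)
      (-(π / L) * Real.tan (π * y / L) / Real.sin (π * x / L) ^ 2) x := by
  have hph := phase_mem_Ioo hL hx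
  have hcos : Real.cos (π * x / L) ≠ 0 :=
    (Real.cos_pos_of_mem_Ioo ⟨by linarith [hph.1, Real.pi_pos], hph.2⟩).ne'
  have hsin : Real.sin (π * x / L) ≠ 0 :=
    (Real.sin_pos_of_pos_of_lt_pi hph.1 (by linarith [hph.2, Real.pi_pos])).ne'
  have htan : Real.tan (π * x / L) ≠ 0 := (tan_phase_pos hL hx).ne'
  have hμ : HasDerivAt (fun x : ℝ => π * x / L) (π / L) x := by
    have h := ((hasDerivAt_id x).const_mul π).div_const L
    simpa [mul_comm] using h
  have ht : HasDerivAt (fun x => Real.tan (π * x / L))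
      (1 / Real.cos (π * x / L) ^ 2 * (π / L)) x := by
    have h := (Real.hasDerivAt_tan hcos).comp x hμ
    simpa [Function.comp_def] using h
  have hinv := ht.inv htan
  have h := hinv.const_mul (Real.tan (π * y / L))
  refine (h.congr_of_eventuallyEq (Eventually.of_forall fun z => ?_)).congr_deriv ?_
  · simp only [hlRatio, Pi.inv_apply, div_eq_mul_inv]
  · simp only [Real.tan_eq_sin_div_cos]
    field_simp

/-- **`G := K_x`**, CHKLSY's notation (p. 12): `G(x,y) = −μ tan(μy) sin⁻²(μx) · φ′(s(x,y))`
(printed as `−μ csc²(μx) tan(μy){log|(s+1)/(s−1)| − 2s/(s²−1)}`).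
[cite: ChoiHouKiselevLuoSverakYao2017, §4 proof of Lemma 7, p. 12 (G = K_x)] -/
def hlKernelDx (L x y : ℝ) : ℝ :=
  -(π / L) * Real.tan (π * y / L) / Real.sin (π * x / L) ^ 2 * hlKernelFnDeriv (hlRatio L x y)

/-- **`K_x = G`** off the diagonal: for `x ≠ y` in `(0, ½L)`, `x ↦ K(x,y)` has derivative
`G(x,y)` (chain rule, `s(x,y) ≠ ±1`). [cite: ChoiHouKiselevLuoSverakYao2017, §4 proof of Lemma 7, p. 12 (G = K_x)] -/
theorem hasDerivAt_hlKernel_left {L x y : ℝ} (hL : 0 < L) (hx : x ∈ Ioo 0 (L / 2))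
    (hy : y ∈ Ioo 0 (L / 2)) (hxy : x ≠ y) :
    HasDerivAt (fun x => hlKernel L x y) (hlKernelDx L x y) x := by
  have hs0 : 0 < hlRatio L x y := div_pos (tan_phase_pos hL hy) (tan_phase_pos hL hx)
  have hs1 : hlRatio L x y ≠ 1 := by
    rcases lt_or_gt_of_ne hxy with h | h
    · exact (one_lt_hlRatio hL hx hy h).ne'
    · exact (hlRatio_mem_Ioo hL hx hy h).2.ne
  have hs2 : hlRatio L x y ≠ -1 := by linarith
  have h := (hasDerivAt_hlKernelFn_deriv hs1 hs2).comp x (hasDerivAt_hlRatio_left hL hx y)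
  refine h.congr_deriv ?_
  rw [hlKernelDx]
  ring

/-- **The symmetrised kernel `T(x,y) := cot(μy) G(x,y) + cot(μx) G(y,x)`** of the proof of Lemma 7
((eqn_ww_s): `I₂ = (1/2π)∫∫ ω_r(x) ω_r(y) T(x,y)`). [cite: ChoiHouKiselevLuoSverakYao2017, §4 proof of Lemma 7, p. 12 (T(x,y))] -/
def hlSymKernel (L x y : ℝ) : ℝ :=
  Real.cot (π * y / L) * hlKernelDx L x y + Real.cot (π * x / L) * hlKernelDx L y x

/-- The algebra behind `T ≤ 0`: with `t₁ = tan(μx)`, `t₂ = tan(μy)` (positive, distinct),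
`s = t₂/t₁`, `ℓ ≥ 2s/(s²+1)` and `r = 2s/(s²−1)`, the bracket
`(1+t₁²)/t₁²·(ℓ − r) + (1+t₂²)/t₂²·(ℓ + r)` is at least `4t₁t₂/(t₁²+t₂²)`. [folklore] -/
private theorem symKernel_bracket_ge {t₁ t₂ ℓ : ℝ} (h1 : 0 < t₁) (h2 : 0 < t₂) (hne : t₁ ≠ t₂)
    (hℓ : 2 * (t₂ / t₁) / ((t₂ / t₁) ^ 2 + 1) ≤ ℓ) :
    4 * t₁ * t₂ / (t₁ ^ 2 + t₂ ^ 2) ≤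
      (1 + t₁ ^ 2) / t₁ ^ 2 * (ℓ - 2 * (t₂ / t₁) / ((t₂ / t₁) ^ 2 - 1)) +
        (1 + t₂ ^ 2) / t₂ ^ 2 * (ℓ + 2 * (t₂ / t₁) / ((t₂ / t₁) ^ 2 - 1)) := by
  have ht1 : t₁ ≠ 0 := h1.ne'
  have ht2 : t₂ ≠ 0 := h2.ne'
  have hd : t₂ ^ 2 - t₁ ^ 2 ≠ 0 := by
    intro h
    have : (t₂ - t₁) * (t₂ + t₁) = 0 := by nlinarith
    rcases mul_eq_zero.1 this with h' | h'
    · exact hne (by linarith)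
    · linarith
  -- rewrite `ℓ₀` and `r` in terms of `t₁, t₂`
  have hℓ0 : 2 * (t₂ / t₁) / ((t₂ / t₁) ^ 2 + 1) = 2 * t₁ * t₂ / (t₁ ^ 2 + t₂ ^ 2) := by
    field_simp
    ring
  have hr : 2 * (t₂ / t₁) / ((t₂ / t₁) ^ 2 - 1) = 2 * t₁ * t₂ / (t₂ ^ 2 - t₁ ^ 2) := by
    have : (t₂ / t₁) ^ 2 - 1 = (t₂ ^ 2 - t₁ ^ 2) / t₁ ^ 2 := by field_simp
    rw [this]
    field_simp
  rw [hℓ0] at hℓ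
  rw [hr]
  -- the value at `ℓ = ℓ₀` is exactly `4 t₁ t₂/(t₁²+t₂²)`; the bracket is increasing in `ℓ`
  have hA : 0 ≤ (1 + t₁ ^ 2) / t₁ ^ 2 + (1 + t₂ ^ 2) / t₂ ^ 2 := by positivity
  have hkey : (1 + t₁ ^ 2) / t₁ ^ 2 * (2 * t₁ * t₂ / (t₁ ^ 2 + t₂ ^ 2) -
      2 * t₁ * t₂ / (t₂ ^ 2 - t₁ ^ 2)) + (1 + t₂ ^ 2) / t₂ ^ 2 *
      (2 * t₁ * t₂ / (t₁ ^ 2 + t₂ ^ 2) + 2 * t₁ * t₂ / (t₂ ^ 2 - t₁ ^ 2)) =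
      4 * t₁ * t₂ / (t₁ ^ 2 + t₂ ^ 2) := by
    have hsum : t₁ ^ 2 + t₂ ^ 2 ≠ 0 := by positivity
    field_simp
    ring
  have hmono : (1 + t₁ ^ 2) / t₁ ^ 2 * (2 * t₁ * t₂ / (t₁ ^ 2 + t₂ ^ 2) -
      2 * t₁ * t₂ / (t₂ ^ 2 - t₁ ^ 2)) + (1 + t₂ ^ 2) / t₂ ^ 2 *
      (2 * t₁ * t₂ / (t₁ ^ 2 + t₂ ^ 2) + 2 * t₁ * t₂ / (t₂ ^ 2 - t₁ ^ 2)) ≤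
      (1 + t₁ ^ 2) / t₁ ^ 2 * (ℓ - 2 * t₁ * t₂ / (t₂ ^ 2 - t₁ ^ 2)) +
      (1 + t₂ ^ 2) / t₂ ^ 2 * (ℓ + 2 * t₁ * t₂ / (t₂ ^ 2 - t₁ ^ 2)) := by
    have h1' : 0 ≤ (1 + t₁ ^ 2) / t₁ ^ 2 := by positivity
    have h2' : 0 ≤ (1 + t₂ ^ 2) / t₂ ^ 2 := by positivity
    nlinarith [mul_le_mul_of_nonneg_left hℓ h1', mul_le_mul_of_nonneg_left hℓ h2']
  linarith [hkey, hmono]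

/-- **`T(x,y) ≤ 0`** (p. 12: "We shall show that `T(x,y) ≤ 0` for all `x, y ∈ (0, ½L)`, which
then implies `I₂ ≤ 0`"), for `x ≠ y` in `(0, ½L)`, in the quantitative form
`T(x,y) ≤ −4μ tan(μx)tan(μy)/(tan²(μx) + tan²(μy))` (from `log|(s+1)/(s−1)| ≥ 2s/(s²+1)`, as
printed; `T = −μ[(csc²μx + csc²μy) log|…| − (csc²μx − csc²μy)·2s/(s²−1)]`).
[cite: ChoiHouKiselevLuoSverakYao2017, §4 proof of Lemma 7, p. 12 (T(x,y) ≤ 0)] -/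
theorem hlSymKernel_le {L x y : ℝ} (hL : 0 < L) (hx : x ∈ Ioo 0 (L / 2)) (hy : y ∈ Ioo 0 (L / 2))
    (hxy : x ≠ y) :
    hlSymKernel L x y ≤ -(4 * (π / L) * Real.tan (π * x / L) * Real.tan (π * y / L) /
      (Real.tan (π * x / L) ^ 2 + Real.tan (π * y / L) ^ 2)) := by
  have hphx := phase_mem_Ioo hL hx
  have hphy := phase_mem_Ioo hL hy
  set t₁ : ℝ := Real.tan (π * x / L) with ht₁
  set t₂ : ℝ := Real.tan (π * y / L) with ht₂
  have h1 : 0 < t₁ := tan_phase_pos hL hx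
  have h2 : 0 < t₂ := tan_phase_pos hL hy
  have hne : t₁ ≠ t₂ := by
    intro h
    rcases lt_or_gt_of_ne hxy with hlt | hgt
    · have := tan_phase_lt hL hx hy hlt
      rw [← ht₁, ← ht₂] at this; linarith
    · have := tan_phase_lt hL hy hx hgt
      rw [← ht₁, ← ht₂] at this; linarith
  have hcosx : Real.cos (π * x / L) ≠ 0 :=
    (Real.cos_pos_of_mem_Ioo ⟨by linarith [hphx.1, Real.pi_pos], hphx.2⟩).ne'
  have hcosy : Real.cos (π * y / L) ≠ 0 :=
    (Real.cos_pos_of_mem_Ioo ⟨by linarith [hphy.1, Real.pi_pos], hphy.2⟩).ne'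
  -- `sin² = t²/(1+t²)`, `cot = 1/t`
  have hsinx : Real.sin (π * x / L) ^ 2 = t₁ ^ 2 / (1 + t₁ ^ 2) :=
    (Real.tan_sq_div_one_add_tan_sq hcosx).symm
  have hsiny : Real.sin (π * y / L) ^ 2 = t₂ ^ 2 / (1 + t₂ ^ 2) :=
    (Real.tan_sq_div_one_add_tan_sq hcosy).symm
  have hcotx : Real.cot (π * x / L) = 1 / t₁ := by
    rw [Real.cot_eq_cos_div_sin, ht₁, Real.tan_eq_sin_div_cos, one_div, inv_div]
  have hcoty : Real.cot (π * y / L) = 1 / t₂ := by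
    rw [Real.cot_eq_cos_div_sin, ht₂, Real.tan_eq_sin_div_cos, one_div, inv_div]
  -- the two ratios: `s = t₂/t₁`, `s(y,x) = 1/s`
  have hsxy : hlRatio L x y = t₂ / t₁ := rfl
  have hsyx : hlRatio L y x = 1 / (t₂ / t₁) := by rw [hlRatio, ← ht₁, ← ht₂]; field_simp
  set s : ℝ := t₂ / t₁ with hs
  have hs0 : 0 < s := div_pos h2 h1
  have hs1 : s ≠ 1 := by
    intro h; rw [hs, div_eq_one_iff_eq h1.ne'] at h; exact hne h.symm
  have hs2 : s ≠ -1 := by linarith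
  -- `φ′(s) = ℓ − r`, `φ′(1/s) = ℓ + r`
  set ℓ : ℝ := Real.log |(s + 1) / (s - 1)| with hℓ
  have hφ1 : hlKernelFnDeriv s = ℓ - 2 * s / (s ^ 2 - 1) := hlKernelFnDeriv_eq_abs s
  have hφ2 : hlKernelFnDeriv (1 / s) = ℓ + 2 * s / (s ^ 2 - 1) := hlKernelFnDeriv_inv hs0.ne' hs1 hs2
  have hℓge : 2 * s / (s ^ 2 + 1) ≤ ℓ := two_mul_div_le_log_ratio hs0.le hs1
  -- rewrite `T`
  have hT : hlSymKernel L x y = -(π / L) * ((1 + t₁ ^ 2) / t₁ ^ 2 * (ℓ - 2 * s / (s ^ 2 - 1)) +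
      (1 + t₂ ^ 2) / t₂ ^ 2 * (ℓ + 2 * s / (s ^ 2 - 1))) := by
    have hs3 : s ^ 2 - 1 ≠ 0 := by
      intro h
      have : (s - 1) * (s + 1) = 0 := by nlinarith
      rcases mul_eq_zero.1 this with h' | h'
      · exact hs1 (by linarith)
      · exact hs2 (by linarith)
    rw [hlSymKernel, hlKernelDx, hlKernelDx, hsxy, hsyx, hφ1, hφ2, hcotx, hcoty, hsinx, hsiny,
      ← ht₁, ← ht₂]
    field_simp
    ring
  rw [hT]
  have hb := symKernel_bracket_ge (ℓ := ℓ) h1 h2 hne hℓge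
  have hμ : 0 < π / L := div_pos Real.pi_pos hL
  have : π / L * (4 * t₁ * t₂ / (t₁ ^ 2 + t₂ ^ 2)) ≤ π / L * ((1 + t₁ ^ 2) / t₁ ^ 2 *
      (ℓ - 2 * s / (s ^ 2 - 1)) + (1 + t₂ ^ 2) / t₂ ^ 2 * (ℓ + 2 * s / (s ^ 2 - 1))) :=
    mul_le_mul_of_nonneg_left hb hμ.le
  have heq : 4 * (π / L) * t₁ * t₂ / (t₁ ^ 2 + t₂ ^ 2) = π / L * (4 * t₁ * t₂ / (t₁ ^ 2 + t₂ ^ 2)) := by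
    ring
  rw [heq]
  linarith

/-- **`T(x,y) ≤ 0`** as printed. [cite: ChoiHouKiselevLuoSverakYao2017, §4 proof of Lemma 7, p. 12 (T(x,y) ≤ 0)] -/
theorem hlSymKernel_nonpos {L x y : ℝ} (hL : 0 < L) (hx : x ∈ Ioo 0 (L / 2))
    (hy : y ∈ Ioo 0 (L / 2)) (hxy : x ≠ y) : hlSymKernel L x y ≤ 0 := by
  refine (hlSymKernel_le hL hx hy hxy).trans ?_
  have h1 := tan_phase_pos hL hx
  have h2 := tan_phase_pos hL hy
  have : 0 ≤ 4 * (π / L) * Real.tan (π * x / L) * Real.tan (π * y / L) /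
      (Real.tan (π * x / L) ^ 2 + Real.tan (π * y / L) ^ 2) := by positivity
  linarith

end ChoiEtAl2017

end Literature.Analysis.FluidPDE
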